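import Literature.MathematicalPhysics.QuantumFieldTheory.Balaban1983to89.B1DeltaGRegularRegion
import Literature.MathematicalPhysics.QuantumFieldTheory.Balaban1983to89.B1Cor23RegularDiagFam

/-!
# `Balaban1983to89.B1DeltaGDerivRegularRegion` — [Balaban1983RegularityDecay] **(1.11) / Cor. 2.3 (2.30) second sentence: THE THREE
# DERIVATIVE PAIRINGS OF THE DIFFERENCE `δG_k(Ω,Ω₀,A) = G_k(Ω,A) − G_k(Ω₀,A)`** — `⟨h, D^ε_AδG_k g′⟩`, `⟨g, δG_kD^{ε*}_Ah′⟩`,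
# `⟨h, D^ε_AδG_kD^{ε*}_Ah′⟩` — AT A REGULAR `A` FOR NESTED REGIONS `Ω ⊆ Ω₀` of `T_ε` on the CONCRETE (Higgs)₂,₃ carrier
# (`HiggsCovariance.propagatorK`), for ANY cutoff adapted to `(Ω, Ω₀)`: the companion of r14 g14's `B1DeltaGRegularRegion` (plain pairing)

statement-level skeleton of published theorems with citation tags; proofs where landed; nothing here is a claim about the Yang–Mills mass gap

PDF held: `paper:balaban1983-cmp89-regularity-decay` p. 573 [PDF 3] ((1.11)–(1.12)), pp. 580–581 [PDF 10–11] (Cor. 2.3); [Balaban1982Higgs1] =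
`paper:balaban1982-cmp85-higgs23-i` p. 605 (1.7), p. 610 (2.20)–(2.23).

CITATION HEADER (lean-in-tree rule).  T. Bałaban, *Regularity and decay of lattice Green's functions*, Commun. Math. Phys. **89** (1983) 571–597
[Balaban1983RegularityDecay], (1.11) p. 573, Cor. 2.3 (2.30) pp. 580–581; [Balaban1982Higgs1] (1.7) p. 605, (2.20)–(2.23) p. 610.  Cell
`lit-balaban`, reader/typer seat **r14** gen 15 (unit `lit-balaban-r14`; TAKING line HOME/STATUS.md 2026-08-22T14:05:59Z; design note
`lit-balaban-r14/DESIGN-deltaG-pairings.md` ADDENDUM steps 5–6); SKELETON rows **B1.Prop2.3 / B1.Prop2.1** (cells: the `δG`-input of (2.38)/(5.5) at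
the `G`-level, derivative variants) and r01's **B4.Cor2.3** (model-instance material; no head change).  USED BY NAME, never restated: r14 g14
`B1DeltaGRegularRegion.{covDeriv_smulFun, siteInner_smulFun_comm, abs_lap_commutator_le, projPk_commutator_le, restricted_norm_G_le, restricted_norm_DG_le}`,
`B1Cor23DerivRegularRegion.{pairing_DG_of_coercive, pairing_DG_of_coercive_any, pairing_GDt_of_coercive, pairing_DGDt_of_coercive, siteInner_adjCovDeriv,
adjCovDeriv_supported}`, `B1Cor23RegularRegion.{pairing_of_coercive, propagatorK_supported}`, `B1Cor23RegularDiagFam.adjA` (the explicit `D^{ε*}_A`); typer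
`HiggsCovariancePos.{covOpK_propagatorK_apply, propagatorK_covOpK_apply, shift_unshift, sum_site_dir}`, `B1Eq230FluctCovPos.siteInner_propagatorK_comm`,
`B1Cor23DerivZeroFieldRegion.bondInner_comm`, `B1Ineq233Upper.sum_bond_src_sq`, `B1Ineq234LevelZero.{tdist_comm, tdist_triangle_real, tdist_shift_le_one}`,
`B1Ineq234Concrete.tdist_self`.

WHAT IS PRINTED (verbatim, [13] pp. 580–581 [PDF 10–11]): *"Corollary 2.3. If Ω and A are as in Proposition I.2.1, then there exist positive constants
c₀, δ₀ such that for arbitrary scalar field configurations f, f′ defined on Ω, we have |⟨f, G_k(Ω,A)f′⟩|, |⟨f, D^η_{A,μ}G_k(Ω,A)f′⟩|,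
|⟨f, G_k(Ω,A)D^{η*}_{A,ν}f′⟩|, |⟨f, D^η_{A,μ}G_k(Ω,A)D^{η*}_{A,ν}f′⟩| ≤ c₀e^{−δ₀dist(supp f, supp f′)}‖f‖₂‖f′‖₂. (2.30) The same inequalities
hold for δG_k(Ω,Ω₀,A) with the additional factor e^{−δ₀(dist(supp f,Ωᶜ)+dist(supp f′,Ωᶜ))}."*; p. 573 (1.11): *"δG_k(Ω,Ω₀,A) = G_k(Ω,A) − G_k(Ω₀,A)"*
(`Ω ⊂ Ω₀`).

THE ARGUMENT (this file's; NOT the print's random walk — a disclosed divergence serving the printed STATEMENT; same scheme as r14 g14's plain pairing).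
For ARBITRARY site fields `g, g′` and a cutoff `χ` the exact split `⟨g, δGg′⟩ = ⟨g, G_Ω((1−χ)g′)⟩ − ⟨G_Ωg, E⟩ − ⟨(1−χ)g, G_Ω₀g′⟩` holds, `⟨G_Ωg, E⟩` = the
first-order Laplacian commutator + the `P_k(A)` commutator in `(v, u₀) = (G_Ωg, G_Ω₀g′)` (§1 `deltaG_split`), and the commutator is bounded by six
restricted norms of `v, D_Av, u₀, D_Au₀` on the transition set (§1 `commutator_le`).  For the derivative pairings `g = D^{ε*}_Ah` and/or `g′ = D^{ε*}_Ah′`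
(bond fields on the bonds inside `Ω`): the restricted norms of `G_ΩD^{ε*}_Ah` and `D_AG_ΩD^{ε*}_Ah` come by duality from r14 g14's third and fourth pairings
(§2) — one power of `L^kε` less each — and the two boundary terms are rewritten with the covariant Leibniz rule `⟨h, D_A((1−χ)u)⟩ = ⟨(1−χ∘tgt)h, D_Au⟩ −
Σ_b ε^d·ε^{−1}(χ(b₊)−χ(b₋))⟪h(b), u(b₋)⟫` and the adjoint identity `(1−χ)D^{ε*}_Ah′ = D^{ε*}_A((1−χ∘tgt)h′) − m`, `m(x) = ε^{−1}Σ_ν(χ(x+εe_ν) − χ(x))h′(⟨x,ν⟩)`,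
`‖m‖ ≤ κε^{−1}√d‖h′‖` (§3), so that every piece is again one of r14 g14's four pairings or a restricted norm, nonzero only when the relevant support
touches the transition set.

WHAT THIS FILE PROVES (kernel-checked, zero `sorry`, theorems only; axioms standard).
* §1 **`deltaG_split`** (the exact split, no support hypotheses), (private) `sum_bond_le`, **`commutator_le`** (the commutator term from six restricted norms:
  `≤ κε^{−1}√d(a₂b₁ + a₁b₂) + a_k(L^kε)^{−2}·2κ′a₃b₃`).
* §2 (private) `sqrt_le_of_sq_le`, `bondInner_self_nonneg`; `siteInner_adjA`; **`restricted_norm_GDt_le`** (`‖1_TG^ε_k(Ω,A)D^{ε*}_Ah‖ ≤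
  c_D(L^kε)e^{δ}e^{−δr/L^k}‖h‖`), **`restricted_norm_DGDt_le`** (`‖1_SD^ε_AG^ε_k(Ω,A)D^{ε*}_Ah‖ ≤ c₂e^{δ}e^{−δr/L^k}‖h‖`), `c_D = 2/√γ + 4√d·δ/γ`,
  `c₂ = 4 + 2δ(8d/γ)^{1/2}`.
* §3 **`bondInner_covDeriv_oneSub`**, **`oneSub_smul_adjA`**, `bondInner_oneSubTgt_le`, `bondInner_indicator_self_le`, `sqrt_siteInner_oneSub_le`,
  `adjA_zero`, **`siteInner_jumpField_le`** (`‖m‖² ≤ (κε^{−1})²d‖h′‖²`), (private) `exists_of_jumpField_ne_zero`, `abs_sum_jump_le`,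
  `exists_of_bondInner_ne_zero`.
* §4 (private: `exp_shift_one`, `exp_shift_two`, `one_le_exp_mul_of_le_one`, `one_le_exp_of_le_zero`, `tdist_src_tgt_le_one`) **`deltaG_pairing_DG_of_cutoff`** (`|⟨h, D^ε_A(G^ε_k(Ω,A) − G^ε_k(Ω₀,A))g′⟩| ≤ C₁·(L^kε)·e^{−δr/L^k}e^{−δr′/L^k}‖h‖‖g′‖`),
  **`deltaG_pairing_GDt_of_cutoff`** (`|⟨g, (G^ε_k(Ω,A) − G^ε_k(Ω₀,A))D^{ε*}_Ah′⟩|`, by the symmetry of both propagators), **`deltaG_pairing_DGDt_of_cutoff`**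
  (`|⟨h, D^ε_A(G^ε_k(Ω,A) − G^ε_k(Ω₀,A))D^{ε*}_Ah′⟩| ≤ C₃·e^{−δr/L^k}e^{−δr′/L^k}‖h‖‖h′‖`), for `Ω ⊆ Ω₀` unions of `k`-blocks, (2.20)-coercivity `γ` at `A` on
  the `Ω`- and the `Ω₀`-supported fields, admissible `δ`, and ANY cutoff with the hypotheses of `B1DeltaGRegularRegion.deltaG_pairing_of_cutoff`; `r, r′` =
  separations of the supports (bond sources) from the transition set `T`; `C₁, C₃` explicit in `γ, d, δ, a_k, κε^{−1}(L^kε), κ′` — with `κ = 1/(ML^k)`,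
  `κ′ = 1/M` UNIFORM IN `k` (powers `(L^kε)^1`, `(L^kε)^1`, `(L^kε)^0` as for the plain derivative pairings).
HONEST SCOPE.  (i) cutoff, `S, Y, T, r, r′` are HYPOTHESES (the adapted cutoff is `B1DeltaGCutoff`; the printed `dist(supp ·, Ωᶜ)` shape and the typed
`B4.Cor23Printed` packaging for nested pairs are the sibling files `B1DeltaGDerivCutoffPairing` / `B1Cor23RegularNestedFam`); (ii) bond test/source fields
vanish off the bonds INSIDE `Ω` (the Neumann form contains only those; the μ-th component pairing of print is the bond field `1[dir b = μ]f(b₋)`); (iii)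
METHOD divergence from the print (cutoff–commutator, not the random walk), constants explicit and crude; (iv) NOT summit progress.
-/

noncomputable section

open scoped BigOperators InnerProductSpace

namespace Literature.MathematicalPhysics.QuantumFieldTheory.Balaban1983to89.B1DeltaGDerivRegularRegion

open HiggsLattice HiggsAveraging HiggsCovariance HiggsCovariancePos
open HiggsFluctMeasurePos (siteInner_comm siteInner_add_right siteInner_smul_right siteInner_sub_right)
open B2Ineq329ZeroAveraging (mesh_eq)
open B1Cor23RegularRegion (covDeriv_eq pairing_of_coercive propagatorK_supported)
open B1Cor23DerivRegularRegion (pairing_DG_of_coercive pairing_DG_of_coercive_any pairing_GDt_of_coercive pairing_DGDt_of_coercive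
  siteInner_adjCovDeriv adjCovDeriv_supported)
open B1Cor23DerivZeroFieldRegion (bondInner_comm)
open B1DeltaGRegularRegion (covDeriv_smulFun siteInner_smulFun_comm abs_lap_commutator_le projPk_commutator_le restricted_norm_G_le
  restricted_norm_DG_le)
open B1Eq230FluctCovPos (siteInner_propagatorK_comm)
open B1Ineq234Concrete (tdist_self)
open B1Ineq234LevelZero (tdist_comm tdist_triangle_real tdist_shift_le_one)
open B1Ineq233Upper (sum_bond_src_sq)
open B1Cor23RegularDiagFam (adjA)

variable {P : HiggsLattice.Params} {N : ℕ} {k : ℕ}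

/-! ## §1 The exact split of `⟨g, δG_k(Ω,Ω₀,A)g′⟩` and the commutator bound from six restricted norms -/

section Split

variable (C : ChargeData N) (A : HiggsLattice.VecField P 0) {msq a : ℝ}

/-- **THE EXACT SPLIT** (no support hypotheses): for all site fields `g, g′` and every real cutoff `χ`, with `v = G_Ωg`, `u₀ = G_Ω₀g′`,
`⟨g, G_Ωg′⟩ − ⟨g, G_Ω₀g′⟩ = ⟨g, G_Ω((1−χ)g′)⟩ − [(⟨v, −Δ_Ω(χu₀)⟩ − ⟨χv, −Δ_Ω₀u₀⟩) + a_k(L^kε)^{−2}(⟨v, P_k(χu₀)⟩ − ⟨χv, P_ku₀⟩)] − ⟨(1−χ)g, u₀⟩`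
(`H_Ω(χu₀) = χg′ + E`, symmetry of `G_Ω`, the mass terms cancel). [cite: Balaban1983RegularityDecay, (1.11) p.573, Cor. 2.3 p.580]
[cite: Balaban1982Higgs1, (2.20) p.610] -/
theorem deltaG_split (Ω Ω₀ : Finset (HiggsLattice.Site P 0)) (hmsq : 0 < msq) (hak : 0 ≤ B1.aSeq a P.L k)
    (χ : HiggsLattice.Site P 0 → ℝ) (g g' : ScalarField P 0 N) :
    siteInner g (propagatorK C Ω A msq a k g') - siteInner g (propagatorK C Ω₀ A msq a k g')
      = siteInner g (propagatorK C Ω A msq a k (fun x => (1 - χ x) • g' x))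
        - ((siteInner (propagatorK C Ω A msq a k g) (covLaplacianN C Ω A (fun x => χ x • propagatorK C Ω₀ A msq a k g' x))
              - siteInner (fun x => χ x • propagatorK C Ω A msq a k g x) (covLaplacianN C Ω₀ A (propagatorK C Ω₀ A msq a k g')))
            + B1.aSeq a P.L k * ((P.mesh k)⁻¹ ^ 2) *
              (siteInner (propagatorK C Ω A msq a k g) (projPk C A k (fun x => χ x • propagatorK C Ω₀ A msq a k g' x))
                - siteInner (fun x => χ x • propagatorK C Ω A msq a k g x) (projPk C A k (propagatorK C Ω₀ A msq a k g'))))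
        - siteInner (fun x => (1 - χ x) • g x) (propagatorK C Ω₀ A msq a k g') := by
  set u₀ : ScalarField P 0 N := propagatorK C Ω₀ A msq a k g' with hu₀
  set v : ScalarField P 0 N := propagatorK C Ω A msq a k g with hv
  set E : ScalarField P 0 N := covOpK C Ω A msq a k (fun x => χ x • u₀ x) - fun x => χ x • g' x with hE
  -- (a) the algebraic split
  have h1 : (fun x => χ x • u₀ x) = propagatorK C Ω A msq a k (fun x => χ x • g' x) + propagatorK C Ω A msq a k E := by
    have hGH := propagatorK_covOpK_apply C Ω A hmsq a k hak (fun x => χ x • u₀ x)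
    rw [hE, map_sub, hGH]
    abel
  have hB_eq : siteInner g (propagatorK C Ω A msq a k (fun x => (1 - χ x) • g' x))
      = siteInner g (propagatorK C Ω A msq a k g') - siteInner g (propagatorK C Ω A msq a k (fun x => χ x • g' x)) := by
    rw [← siteInner_sub_right, ← map_sub]
    congr 1; congr 1; funext x; simp only [Pi.sub_apply, sub_smul, one_smul]
  have hE_eq : siteInner v E = siteInner g (fun x => χ x • u₀ x) - siteInner g (propagatorK C Ω A msq a k (fun x => χ x • g' x)) := by
    have h2 : siteInner v E = siteInner g (propagatorK C Ω A msq a k E) := by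
      rw [hv, siteInner_propagatorK_comm C Ω A msq a k, siteInner_comm]
    rw [h2, ← siteInner_sub_right]
    congr 1
    rw [h1]; abel
  have hA_eq : siteInner (fun x => (1 - χ x) • g x) u₀ = siteInner g u₀ - siteInner g (fun x => χ x • u₀ x) := by
    rw [← siteInner_smulFun_comm, ← siteInner_sub_right]
    congr 1; funext x; simp only [Pi.sub_apply, sub_smul, one_smul]
  have hsplit : siteInner g (propagatorK C Ω A msq a k g') - siteInner g u₀
      = siteInner g (propagatorK C Ω A msq a k (fun x => (1 - χ x) • g' x)) - siteInner v E
        - siteInner (fun x => (1 - χ x) • g x) u₀ := by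
    rw [hB_eq, hE_eq, hA_eq]; ring
  -- (b) ⟨v, E⟩ = Laplacian commutator + P_k commutator (the mass terms cancel)
  have hvE : siteInner v E
      = (siteInner v (covLaplacianN C Ω A (fun x => χ x • u₀ x)) - siteInner (fun x => χ x • v x) (covLaplacianN C Ω₀ A u₀))
        + B1.aSeq a P.L k * ((P.mesh k)⁻¹ ^ 2) *
          (siteInner v (projPk C A k (fun x => χ x • u₀ x)) - siteInner (fun x => χ x • v x) (projPk C A k u₀)) := by
    have hHu₀ : covOpK C Ω₀ A msq a k u₀ = g' := covOpK_propagatorK_apply C Ω₀ A hmsq a k hak g'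
    have hexp : ∀ (Ω' : Finset (HiggsLattice.Site P 0)) (φ ψ : ScalarField P 0 N), siteInner φ (covOpK C Ω' A msq a k ψ)
        = siteInner φ (covLaplacianN C Ω' A ψ) + msq * siteInner φ ψ
          + B1.aSeq a P.L k * ((P.mesh k)⁻¹ ^ 2) * siteInner φ (projPk C A k ψ) := by
      intro Ω' φ ψ
      rw [covOpK, LinearMap.add_apply, LinearMap.add_apply, LinearMap.smul_apply, LinearMap.smul_apply,
        LinearMap.id_apply, siteInner_add_right, siteInner_add_right, siteInner_smul_right, siteInner_smul_right]
    have hm1 : siteInner v (fun x => χ x • g' x) = siteInner (fun x => χ x • v x) (covOpK C Ω₀ A msq a k u₀) := by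
      rw [hHu₀, siteInner_smulFun_comm]
    have hm2 : siteInner v (fun x => χ x • u₀ x) = siteInner (fun x => χ x • v x) u₀ := siteInner_smulFun_comm χ v u₀
    rw [hE, siteInner_sub_right, hm1, hexp, hexp, hm2]
    ring
  rw [hsplit, hvE]

open Classical in
/-- Cauchy–Schwarz over a bond set against the source values: `Σ_{b∈S} ε^d‖X(b)‖‖w(b₋)‖ ≤ ‖1_SX‖·(√d·‖1_Tw‖)` for `src(S) ⊂ T`. [folklore] -/
private theorem sum_bond_le (S : Finset (HiggsLattice.PBond P 0)) (T : Finset (HiggsLattice.Site P 0))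
    (hST : ∀ b ∈ S, b.src ∈ T) (X : HiggsLattice.PBond P 0 → E N) (w : ScalarField P 0 N) :
    ∑ b ∈ S, P.mesh 0 ^ P.d * (‖X b‖ * ‖w b.src‖)
      ≤ Real.sqrt (bondInner (fun b => if b ∈ S then X b else 0) (fun b => if b ∈ S then X b else 0))
        * (Real.sqrt P.d * Real.sqrt (siteInner (fun x => if x ∈ T then w x else 0) (fun x => if x ∈ T then w x else 0))) := by
  have hmd : 0 ≤ P.mesh 0 ^ P.d := pow_nonneg (P.mesh_pos 0).le _
  set XS : HiggsLattice.PBond P 0 → ℝ := fun b => if b ∈ S then ‖X b‖ else 0 with hXS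
  set wT : ScalarField P 0 N := fun x => if x ∈ T then w x else 0 with hwT
  have h1 : ∑ b ∈ S, P.mesh 0 ^ P.d * (‖X b‖ * ‖w b.src‖) ≤ ∑ b : HiggsLattice.PBond P 0, P.mesh 0 ^ P.d * (XS b * ‖wT b.src‖) := by
    have hz : ∀ b ∈ (Finset.univ : Finset (HiggsLattice.PBond P 0)), b ∉ S → P.mesh 0 ^ P.d * (XS b * ‖wT b.src‖) = 0 := by
      intro b _ hb
      simp only [hXS, if_neg hb, zero_mul, mul_zero]
    rw [← Finset.sum_subset (Finset.subset_univ S) hz]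
    refine Finset.sum_le_sum fun b hb => le_of_eq ?_
    simp only [hXS, hwT, if_pos hb, if_pos (hST b hb)]
  have hcs := Finset.sum_mul_sq_le_sq_mul_sq (Finset.univ : Finset (HiggsLattice.PBond P 0)) XS (fun b => ‖wT b.src‖)
  have h2 : ∑ b : HiggsLattice.PBond P 0, P.mesh 0 ^ P.d * (XS b * ‖wT b.src‖)
      ≤ Real.sqrt (∑ b : HiggsLattice.PBond P 0, P.mesh 0 ^ P.d * XS b ^ 2)
        * Real.sqrt (∑ b : HiggsLattice.PBond P 0, P.mesh 0 ^ P.d * ‖wT b.src‖ ^ 2) := by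
    have hA : |∑ b : HiggsLattice.PBond P 0, XS b * ‖wT b.src‖|
        ≤ Real.sqrt ((∑ b : HiggsLattice.PBond P 0, XS b ^ 2) * ∑ b : HiggsLattice.PBond P 0, ‖wT b.src‖ ^ 2) := Real.abs_le_sqrt hcs
    rw [Real.sqrt_mul (Finset.sum_nonneg fun b _ => sq_nonneg _)] at hA
    have hB := (le_abs_self _).trans hA
    rw [← Finset.mul_sum, ← Finset.mul_sum, ← Finset.mul_sum, Real.sqrt_mul hmd, Real.sqrt_mul hmd]
    have hsc : Real.sqrt (P.mesh 0 ^ P.d) * Real.sqrt (P.mesh 0 ^ P.d) = P.mesh 0 ^ P.d := Real.mul_self_sqrt hmd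
    calc P.mesh 0 ^ P.d * ∑ b : HiggsLattice.PBond P 0, XS b * ‖wT b.src‖
        ≤ P.mesh 0 ^ P.d * (Real.sqrt (∑ b : HiggsLattice.PBond P 0, XS b ^ 2) * Real.sqrt (∑ b : HiggsLattice.PBond P 0, ‖wT b.src‖ ^ 2)) :=
          mul_le_mul_of_nonneg_left hB hmd
      _ = (Real.sqrt (P.mesh 0 ^ P.d) * Real.sqrt (P.mesh 0 ^ P.d)) *
            (Real.sqrt (∑ b : HiggsLattice.PBond P 0, XS b ^ 2) * Real.sqrt (∑ b : HiggsLattice.PBond P 0, ‖wT b.src‖ ^ 2)) := by rw [hsc]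
      _ = _ := by ring
  have e1 : ∑ b : HiggsLattice.PBond P 0, P.mesh 0 ^ P.d * XS b ^ 2
      = bondInner (fun b => if b ∈ S then X b else 0) (fun b => if b ∈ S then X b else 0) := by
    unfold bondInner
    refine Finset.sum_congr rfl fun b _ => ?_
    by_cases hb : b ∈ S
    · simp only [hXS, if_pos hb, real_inner_self_eq_norm_sq]
    · simp only [hXS, if_neg hb, inner_zero_left, mul_zero]
      ring
  have e2 : ∑ b : HiggsLattice.PBond P 0, P.mesh 0 ^ P.d * ‖wT b.src‖ ^ 2 = P.d * siteInner wT wT := sum_bond_src_sq wT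
  rw [e1, e2, Real.sqrt_mul (Nat.cast_nonneg _)] at h2
  exact h1.trans h2

open Classical in
/-- **THE COMMUTATOR TERM FROM SIX RESTRICTED NORMS**: for `Ω ⊆ Ω₀`, a cutoff `χ` vanishing at both ends of the bonds of `Ω₀` not inside `Ω` with
bond jumps `≤ κ`, block oscillation `≤ κ′`, constant on the blocks outside `Y`, a bond set `S ⊇` the jump bonds inside `Ω` with `src S ⊂ T`, and ANY
fields `v, u₀` whose restricted norms obey `‖1_Tv‖ ≤ a₁`, `‖1_SD_Av‖ ≤ a₂`, `‖1_{B^k(Y)}v‖ ≤ a₃`, `‖1_Tu₀‖ ≤ b₁`, `‖1_SD_Au₀‖ ≤ b₂`, `‖1_{B^k(Y)}u₀‖ ≤ b₃`: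
`|(⟨v, −Δ_Ω(χu₀)⟩ − ⟨χv, −Δ_Ω₀u₀⟩) + a_k(L^kε)^{−2}(⟨v, P_k(χu₀)⟩ − ⟨χv, P_ku₀⟩)| ≤ κε^{−1}√d(a₂b₁ + a₁b₂) + a_k(L^kε)^{−2}·2κ′a₃b₃`.
[cite: Balaban1983RegularityDecay, Cor. 2.3 (2.30) p.580] [cite: Balaban1982Higgs1, (2.17), (2.20) p.610] -/
theorem commutator_le (hk : k ≤ P.K) (Ω Ω₀ : Finset (HiggsLattice.Site P 0)) (hsub : Ω ⊆ Ω₀) (hak : 0 ≤ B1.aSeq a P.L k)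
    (χ : HiggsLattice.Site P 0 → ℝ)
    (hχbd : ∀ b : HiggsLattice.PBond P 0, Inside Ω₀ b → ¬ Inside Ω b → χ b.src = 0 ∧ χ b.tgt = 0)
    {κ : ℝ} (hκ0 : 0 ≤ κ) (hκ : ∀ b : HiggsLattice.PBond P 0, |χ b.tgt - χ b.src| ≤ κ)
    (S : Finset (HiggsLattice.PBond P 0)) (hS : ∀ b, Inside Ω b → χ b.tgt ≠ χ b.src → b ∈ S)
    {κ' : ℝ} (hκ'0 : 0 ≤ κ') (hosc : ∀ x x' : HiggsLattice.Site P 0, blockIter k x = blockIter k x' → |χ x - χ x'| ≤ κ')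
    (Y : Finset (HiggsLattice.Site P k))
    (hY : ∀ x x' : HiggsLattice.Site P 0, blockIter k x = blockIter k x' → blockIter k x ∉ Y → χ x = χ x')
    (T : Finset (HiggsLattice.Site P 0)) (hTS : ∀ b ∈ S, b.src ∈ T)
    (v u₀ : ScalarField P 0 N) {a₁ a₂ a₃ b₁ b₂ b₃ : ℝ} (ha₃ : 0 ≤ a₃) (hb₂ : 0 ≤ b₂)
    (hTv : Real.sqrt (siteInner (fun x => if x ∈ T then v x else 0) (fun x => if x ∈ T then v x else 0)) ≤ a₁)
    (hSv : Real.sqrt (bondInner (fun b => if b ∈ S then covDeriv C A v b else 0) (fun b => if b ∈ S then covDeriv C A v b else 0)) ≤ a₂)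
    (hYv : Real.sqrt (siteInner (fun x => if blockIter k x ∈ Y then v x else 0) (fun x => if blockIter k x ∈ Y then v x else 0)) ≤ a₃)
    (hTu : Real.sqrt (siteInner (fun x => if x ∈ T then u₀ x else 0) (fun x => if x ∈ T then u₀ x else 0)) ≤ b₁)
    (hSu : Real.sqrt (bondInner (fun b => if b ∈ S then covDeriv C A u₀ b else 0) (fun b => if b ∈ S then covDeriv C A u₀ b else 0)) ≤ b₂)
    (hYu : Real.sqrt (siteInner (fun x => if blockIter k x ∈ Y then u₀ x else 0) (fun x => if blockIter k x ∈ Y then u₀ x else 0)) ≤ b₃) :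
    |(siteInner v (covLaplacianN C Ω A (fun x => χ x • u₀ x)) - siteInner (fun x => χ x • v x) (covLaplacianN C Ω₀ A u₀))
        + B1.aSeq a P.L k * ((P.mesh k)⁻¹ ^ 2) *
          (siteInner v (projPk C A k (fun x => χ x • u₀ x)) - siteInner (fun x => χ x • v x) (projPk C A k u₀))|
      ≤ κ * (P.mesh 0)⁻¹ * (Real.sqrt P.d * (a₂ * b₁ + a₁ * b₂))
        + B1.aSeq a P.L k * ((P.mesh k)⁻¹ ^ 2) * (2 * κ' * (a₃ * b₃)) := by
  have hm0 : 0 < P.mesh 0 := P.mesh_pos 0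
  have hMi : 0 ≤ (P.mesh k)⁻¹ ^ 2 := by positivity
  have hd0 : 0 ≤ Real.sqrt (P.d : ℝ) := Real.sqrt_nonneg _
  -- the Laplacian commutator
  have hC1 := abs_lap_commutator_le C A Ω Ω₀ hsub χ hχbd hκ0 hκ S hS v u₀
  have hsum1 := sum_bond_le S T hTS (covDeriv C A v) u₀
  have hsum2' := sum_bond_le S T hTS (covDeriv C A u₀) v
  have hsum2 : ∑ b ∈ S, P.mesh 0 ^ P.d * (‖v b.src‖ * ‖covDeriv C A u₀ b‖)
      ≤ Real.sqrt (bondInner (fun b => if b ∈ S then covDeriv C A u₀ b else 0) (fun b => if b ∈ S then covDeriv C A u₀ b else 0))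
        * (Real.sqrt P.d * Real.sqrt (siteInner (fun x => if x ∈ T then v x else 0) (fun x => if x ∈ T then v x else 0))) := by
    refine le_trans (le_of_eq (Finset.sum_congr rfl fun b _ => by rw [mul_comm ‖v b.src‖])) hsum2'
  have hsplit_sum : ∑ b ∈ S, P.mesh 0 ^ P.d * (‖covDeriv C A v b‖ * ‖u₀ b.src‖ + ‖v b.src‖ * ‖covDeriv C A u₀ b‖)
      = ∑ b ∈ S, P.mesh 0 ^ P.d * (‖covDeriv C A v b‖ * ‖u₀ b.src‖) + ∑ b ∈ S, P.mesh 0 ^ P.d * (‖v b.src‖ * ‖covDeriv C A u₀ b‖) := by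
    rw [← Finset.sum_add_distrib]; exact Finset.sum_congr rfl fun b _ => by ring
  have hlap : |siteInner v (covLaplacianN C Ω A (fun x => χ x • u₀ x)) - siteInner (fun x => χ x • v x) (covLaplacianN C Ω₀ A u₀)|
      ≤ κ * (P.mesh 0)⁻¹ * (Real.sqrt P.d * (a₂ * b₁ + a₁ * b₂)) := by
    refine hC1.trans ?_
    rw [hsplit_sum]
    refine mul_le_mul_of_nonneg_left ?_ (by positivity)
    have t1 : ∑ b ∈ S, P.mesh 0 ^ P.d * (‖covDeriv C A v b‖ * ‖u₀ b.src‖) ≤ a₂ * (Real.sqrt P.d * b₁) :=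
      hsum1.trans (mul_le_mul hSv (mul_le_mul_of_nonneg_left hTu hd0) (by positivity) (le_trans (Real.sqrt_nonneg _) hSv))
    have t2 : ∑ b ∈ S, P.mesh 0 ^ P.d * (‖v b.src‖ * ‖covDeriv C A u₀ b‖) ≤ b₂ * (Real.sqrt P.d * a₁) :=
      hsum2.trans (mul_le_mul hSu (mul_le_mul_of_nonneg_left hTv hd0) (by positivity) hb₂)
    calc _ ≤ _ := add_le_add t1 t2
      _ = Real.sqrt P.d * (a₂ * b₁ + a₁ * b₂) := by ring
  -- the P_k commutator
  have hC2 := projPk_commutator_le C A hk χ hκ'0 hosc Y hY v u₀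
  have hproj : |siteInner v (projPk C A k (fun x => χ x • u₀ x)) - siteInner (fun x => χ x • v x) (projPk C A k u₀)|
      ≤ 2 * κ' * (a₃ * b₃) := by
    refine hC2.trans ?_
    rw [mul_assoc (2 * κ')]
    exact mul_le_mul_of_nonneg_left (mul_le_mul hYv hYu (Real.sqrt_nonneg _) ha₃) (by positivity)
  refine (abs_add_le _ _).trans (add_le_add hlap ?_)
  rw [abs_mul, abs_of_nonneg (mul_nonneg hak hMi)]
  exact mul_le_mul_of_nonneg_left hproj (mul_nonneg hak hMi)

end Split

/-! ## §2 Restricted norms of `G_k(Ω,A)D^{ε*}_Ah` and `D_AG_k(Ω,A)D^{ε*}_Ah` with decay, by duality from the third and fourth pairings -/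

section Restricted

variable (C : ChargeData N) (A : HiggsLattice.VecField P 0) {msq a : ℝ}

/-- `‖a‖² ≤ K·‖a‖·b`, `K, b ≥ 0` ⇒ `‖a‖ ≤ K·b` for `‖a‖ = √s`. [folklore] -/
private theorem sqrt_le_of_sq_le {s K b : ℝ} (hs : 0 ≤ s) (hK : 0 ≤ K) (hb : 0 ≤ b) (h : s ≤ K * Real.sqrt s * b) :
    Real.sqrt s ≤ K * b := by
  by_cases h0 : Real.sqrt s = 0
  · rw [h0]; positivity
  · have hpos : 0 < Real.sqrt s := lt_of_le_of_ne (Real.sqrt_nonneg _) (Ne.symm h0)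
    have h1 : Real.sqrt s * Real.sqrt s ≤ (K * b) * Real.sqrt s := by
      rw [Real.mul_self_sqrt hs]; linarith
    exact le_of_mul_le_mul_right h1 hpos

/-- `⟨φ, D^{ε*}_Ah⟩ = ⟨D^ε_Aφ, h⟩_{bonds}` for the explicit adjoint `adjA` (`B1Cor23DerivRegularRegion.siteInner_adjCovDeriv`).
[cite: Balaban1982Higgs1, (1.7)–(1.8) p.605] -/
theorem siteInner_adjA (φ : ScalarField P 0 N) (h : HiggsLattice.PBond P 0 → E N) :
    siteInner φ (adjA C A h) = bondInner (covDeriv C A φ) h :=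
  siteInner_adjCovDeriv C A φ h

/-- `bondInner` of a bond field with itself is nonnegative. [folklore] -/
private theorem bondInner_self_nonneg (h : HiggsLattice.PBond P 0 → E N) : 0 ≤ bondInner h h := by
  unfold bondInner
  exact Finset.sum_nonneg fun b _ => mul_nonneg (pow_nonneg (P.mesh_pos 0).le _) real_inner_self_nonneg

open Classical in
/-- **Restricted norm of `G^ε_k(Ω,A)D^{ε*}_Ah` with decay**: for a bond field `h` vanishing off the bonds inside `Ω` and a site set `T` with
`r ≤ |b₋ − t|` whenever `h(b) ≠ 0`, `t ∈ T`: `‖1_TG^ε_k(Ω,A)D^{ε*}_Ah‖ ≤ (2/√γ + 4√d·δ/γ)(L^kε)e^{δ}e^{−δr/L^k}‖h‖` (the third pairing with the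
restricted field itself as test function). [cite: Balaban1983RegularityDecay, Cor. 2.3 (2.30) p.580] -/
theorem restricted_norm_GDt_le (hk : k ≤ P.K) (Ω : Finset (HiggsLattice.Site P 0))
    (hΩ : ∀ x x' : HiggsLattice.Site P 0, blockIter k x = blockIter k x' → (x ∈ Ω ↔ x' ∈ Ω))
    (hmsq : 0 < msq) (hak : 0 ≤ B1.aSeq a P.L k) {γ : ℝ} (hγ : 0 < γ)
    (hlow : ∀ w : ScalarField P 0 N, (∀ x, x ∉ Ω → w x = 0) →
      γ * ((P.mesh k)⁻¹ ^ 2) * siteInner w w ≤ siteInner w (covOpK C Ω A msq a k w))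
    {δ : ℝ} (hδ0 : 0 ≤ δ) (hδ1 : δ ≤ 1) (hδ : 2 * (2 * P.d * δ ^ 2 + B1.aSeq a P.L k * (2 * δ)) ≤ γ)
    (T : Finset (HiggsLattice.Site P 0)) (h : HiggsLattice.PBond P 0 → E N) (hh : ∀ b, ¬ Inside Ω b → h b = 0) (r : ℝ)
    (hsep : ∀ b : HiggsLattice.PBond P 0, h b ≠ 0 → ∀ t ∈ T, r ≤ (HiggsLattice.Site.tdist b.src t : ℝ)) :
    Real.sqrt (siteInner (fun x => if x ∈ T then propagatorK C Ω A msq a k (adjA C A h) x else 0)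
        (fun x => if x ∈ T then propagatorK C Ω A msq a k (adjA C A h) x else 0))
      ≤ (2 / Real.sqrt γ + 4 * Real.sqrt P.d * δ / γ) * P.mesh k * Real.exp δ *
          Real.exp (-(δ * (r / (P.L : ℝ) ^ k))) * Real.sqrt (bondInner h h) := by
  set gS : ScalarField P 0 N := fun x => if x ∈ T then propagatorK C Ω A msq a k (adjA C A h) x else 0 with hgS
  have hkey : siteInner gS gS = siteInner gS (propagatorK C Ω A msq a k (adjA C A h)) := by
    unfold siteInner
    refine Finset.sum_congr rfl fun x _ => ?_
    by_cases hx : x ∈ T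
    · simp only [hgS, if_pos hx]
    · simp only [hgS, if_neg hx, inner_zero_left]
  have hsep' : ∀ (b : HiggsLattice.PBond P 0) (x : HiggsLattice.Site P 0), h b ≠ 0 → gS x ≠ 0 →
      r ≤ (HiggsLattice.Site.tdist b.src x : ℝ) := by
    intro b x hb hx
    have hxT : x ∈ T := by
      by_contra h'; exact hx (by simp only [hgS, if_neg h'])
    exact hsep b hb x hxT
  have hp := pairing_GDt_of_coercive C A hk Ω hΩ hmsq hak hγ hlow hδ0 hδ1 hδ gS h hh r hsep'
  change |siteInner gS (propagatorK C Ω A msq a k (adjA C A h))| ≤ _ at hp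
  rw [← hkey] at hp
  have h1 : siteInner gS gS ≤ (2 / Real.sqrt γ + 4 * Real.sqrt P.d * δ / γ) * P.mesh k * Real.exp δ *
      Real.exp (-(δ * (r / (P.L : ℝ) ^ k))) * Real.sqrt (siteInner gS gS) * Real.sqrt (bondInner h h) := (le_abs_self _).trans hp
  have hK : 0 ≤ (2 / Real.sqrt γ + 4 * Real.sqrt P.d * δ / γ) * P.mesh k * Real.exp δ * Real.exp (-(δ * (r / (P.L : ℝ) ^ k))) := by
    have := P.mesh_pos k; positivity
  exact sqrt_le_of_sq_le (siteInner_self_nonneg gS) hK (Real.sqrt_nonneg _) h1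

open Classical in
/-- **Restricted bond norm of `D^ε_AG^ε_k(Ω,A)D^{ε*}_Ah` with decay**: for a bond field `h` vanishing off the bonds inside `Ω` and a bond set `S`
inside `Ω` with `r ≤ |B₋ − b₋|, |B₋ − b₊|` whenever `B ∈ S`, `h(b) ≠ 0`: `‖1_SD^ε_AG^ε_k(Ω,A)D^{ε*}_Ah‖ ≤ (4 + 2δ(8d/γ)^{1/2})e^{δ}e^{−δr/L^k}‖h‖` (the
fourth pairing with the restricted bond field itself as test function). [cite: Balaban1983RegularityDecay, Cor. 2.3 (2.30) p.580] -/
theorem restricted_norm_DGDt_le (hk : k ≤ P.K) (Ω : Finset (HiggsLattice.Site P 0))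
    (hΩ : ∀ x x' : HiggsLattice.Site P 0, blockIter k x = blockIter k x' → (x ∈ Ω ↔ x' ∈ Ω))
    (hmsq : 0 < msq) (hak : 0 ≤ B1.aSeq a P.L k) {γ : ℝ} (hγ : 0 < γ)
    (hlow : ∀ w : ScalarField P 0 N, (∀ x, x ∉ Ω → w x = 0) →
      γ * ((P.mesh k)⁻¹ ^ 2) * siteInner w w ≤ siteInner w (covOpK C Ω A msq a k w))
    {δ : ℝ} (hδ0 : 0 ≤ δ) (hδ1 : δ ≤ 1) (hδ : 2 * (2 * P.d * δ ^ 2 + B1.aSeq a P.L k * (2 * δ)) ≤ γ)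
    (S : Finset (HiggsLattice.PBond P 0)) (hS : ∀ b ∈ S, Inside Ω b)
    (h : HiggsLattice.PBond P 0 → E N) (hh : ∀ b, ¬ Inside Ω b → h b = 0) (r : ℝ)
    (hsep : ∀ B ∈ S, ∀ b : HiggsLattice.PBond P 0, h b ≠ 0 →
      r ≤ (HiggsLattice.Site.tdist B.src b.src : ℝ) ∧ r ≤ (HiggsLattice.Site.tdist B.src b.tgt : ℝ)) :
    Real.sqrt (bondInner (fun b => if b ∈ S then covDeriv C A (propagatorK C Ω A msq a k (adjA C A h)) b else 0)
        (fun b => if b ∈ S then covDeriv C A (propagatorK C Ω A msq a k (adjA C A h)) b else 0))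
      ≤ (4 + 2 * δ * Real.sqrt (8 * P.d / γ)) * Real.exp δ * Real.exp (-(δ * (r / (P.L : ℝ) ^ k))) * Real.sqrt (bondInner h h) := by
  set HS : HiggsLattice.PBond P 0 → E N := fun b => if b ∈ S then covDeriv C A (propagatorK C Ω A msq a k (adjA C A h)) b else 0
    with hHS
  have hkey : bondInner HS HS = bondInner HS (covDeriv C A (propagatorK C Ω A msq a k (adjA C A h))) := by
    unfold bondInner
    refine Finset.sum_congr rfl fun b _ => ?_
    by_cases hb : b ∈ S
    · simp only [hHS, if_pos hb]
    · simp only [hHS, if_neg hb, inner_zero_left]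
  have hHSsupp : ∀ b, ¬ Inside Ω b → HS b = 0 := by
    intro b hb
    have : b ∉ S := fun h' => hb (hS b h')
    simp only [hHS, if_neg this]
  have hsep' : ∀ B b : HiggsLattice.PBond P 0, HS B ≠ 0 → h b ≠ 0 →
      r ≤ (HiggsLattice.Site.tdist B.src b.src : ℝ) ∧ r ≤ (HiggsLattice.Site.tdist B.src b.tgt : ℝ) := by
    intro B b hB hb
    have hBS : B ∈ S := by
      by_contra h'; exact hB (by simp only [hHS, if_neg h'])
    exact hsep B hBS b hb
  have hp := pairing_DGDt_of_coercive C A hk Ω hΩ hmsq hak hγ hlow hδ0 hδ1 hδ HS h hHSsupp hh r hsep'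
  change |bondInner HS (covDeriv C A (propagatorK C Ω A msq a k (adjA C A h)))| ≤ _ at hp
  rw [← hkey] at hp
  have h0 : 0 ≤ bondInner HS HS := bondInner_self_nonneg HS
  have h1 : bondInner HS HS ≤ (4 + 2 * δ * Real.sqrt (8 * P.d / γ)) * Real.exp δ * Real.exp (-(δ * (r / (P.L : ℝ) ^ k))) *
      Real.sqrt (bondInner HS HS) * Real.sqrt (bondInner h h) := (le_abs_self _).trans hp
  have hK : 0 ≤ (4 + 2 * δ * Real.sqrt (8 * P.d / γ)) * Real.exp δ * Real.exp (-(δ * (r / (P.L : ℝ) ^ k))) := by positivity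
  exact sqrt_le_of_sq_le h0 hK (Real.sqrt_nonneg _) h1

end Restricted

/-! ## §3 The covariant Leibniz rule on `(1 − χ)` for the boundary terms and the adjoint identity -/

section Leibniz

variable (C : ChargeData N) (A : HiggsLattice.VecField P 0)

/-- **`⟨h, D_A((1−χ)u)⟩ = ⟨(1−χ∘tgt)h, D_Au⟩ − Σ_b ε^d·ε^{−1}(χ(b₊) − χ(b₋))⟪h(b), u(b₋)⟫`** (the covariant Leibniz rule for the scalar factor `1 − χ`).
[cite: Balaban1982Higgs1, (1.7) p.605] -/
theorem bondInner_covDeriv_oneSub (χ : HiggsLattice.Site P 0 → ℝ) (h : HiggsLattice.PBond P 0 → E N) (u : ScalarField P 0 N) :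
    bondInner h (covDeriv C A (fun x => (1 - χ x) • u x))
      = bondInner (fun b => (1 - χ b.tgt) • h b) (covDeriv C A u)
        - ∑ b : HiggsLattice.PBond P 0, P.mesh 0 ^ P.d * (((P.mesh 0)⁻¹ * (χ b.tgt - χ b.src)) * ⟪h b, u b.src⟫_ℝ) := by
  unfold bondInner
  rw [← Finset.sum_sub_distrib]
  refine Finset.sum_congr rfl fun b _ => ?_
  have hL := covDeriv_smulFun C A (fun x => 1 - χ x) u b
  rw [hL, inner_add_right, real_inner_smul_right, real_inner_smul_right, real_inner_smul_left]
  ring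

/-- **THE ADJOINT IDENTITY `(1−χ)·D^{ε*}_Ah′ = D^{ε*}_A((1−χ∘tgt)h′) − m`**, `m(x) = ε^{−1}Σ_ν(χ(x + εe_ν) − χ(x))h′(⟨x, ν⟩)` (`U*` is linear; the
target of `⟨x − εe_ν, ν⟩` is `x`, of `⟨x, ν⟩` is `x + εe_ν`). [cite: Balaban1982Higgs1, (1.7)–(1.8) p.605] -/
theorem oneSub_smul_adjA (χ : HiggsLattice.Site P 0 → ℝ) (h' : HiggsLattice.PBond P 0 → E N) :
    (fun x => (1 - χ x) • adjA C A h' x)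
      = adjA C A (fun b => (1 - χ b.tgt) • h' b)
        - fun x => (P.mesh 0)⁻¹ • ∑ ν : Fin P.d, (χ (x.shift ν) - χ x) • h' ⟨x, ν⟩ := by
  funext x
  have ht1 : ∀ ν : Fin P.d, (⟨x.unshift ν, ν⟩ : HiggsLattice.PBond P 0).tgt = x := fun ν => shift_unshift x ν
  have ht2 : ∀ ν : Fin P.d, (⟨x, ν⟩ : HiggsLattice.PBond P 0).tgt = x.shift ν := fun ν => rfl
  simp only [adjA, Pi.sub_apply, ht1, ht2]
  rw [← smul_sub, ← Finset.sum_sub_distrib, smul_comm (1 - χ x) ((P.mesh 0)⁻¹), Finset.smul_sum]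
  congr 1
  refine Finset.sum_congr rfl fun ν _ => ?_
  rw [map_smul, smul_sub]
  module

/-- `‖(1−χ∘tgt)h‖² ≤ ‖h‖²` for `0 ≤ χ ≤ 1`. [cite: Balaban1982Higgs1, (1.5) p.604] -/
theorem bondInner_oneSubTgt_le (χ : HiggsLattice.Site P 0 → ℝ) (hχ0 : ∀ x, 0 ≤ χ x) (hχ1 : ∀ x, χ x ≤ 1)
    (h : HiggsLattice.PBond P 0 → E N) :
    bondInner (fun b => (1 - χ b.tgt) • h b) (fun b => (1 - χ b.tgt) • h b) ≤ bondInner h h := by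
  unfold bondInner
  refine Finset.sum_le_sum fun b _ => mul_le_mul_of_nonneg_left ?_ (pow_nonneg (P.mesh_pos 0).le _)
  rw [real_inner_smul_left, real_inner_smul_right, real_inner_self_eq_norm_sq]
  have h0 : 0 ≤ 1 - χ b.tgt := by linarith [hχ1 b.tgt]
  have h1 : 1 - χ b.tgt ≤ 1 := by linarith [hχ0 b.tgt]
  have hn : 0 ≤ ‖h b‖ ^ 2 := sq_nonneg _
  calc (1 - χ b.tgt) * ((1 - χ b.tgt) * ‖h b‖ ^ 2) ≤ 1 * (1 * ‖h b‖ ^ 2) :=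
        mul_le_mul h1 (mul_le_mul_of_nonneg_right h1 hn) (by positivity) zero_le_one
    _ = ‖h b‖ ^ 2 := by ring

open Classical in
/-- `‖1_Sh‖² ≤ ‖h‖²`. [cite: Balaban1982Higgs1, (1.5) p.604] -/
theorem bondInner_indicator_self_le (S : Finset (HiggsLattice.PBond P 0)) (h : HiggsLattice.PBond P 0 → E N) :
    bondInner (fun b => if b ∈ S then h b else 0) (fun b => if b ∈ S then h b else 0) ≤ bondInner h h := by
  unfold bondInner
  refine Finset.sum_le_sum fun b _ => mul_le_mul_of_nonneg_left ?_ (pow_nonneg (P.mesh_pos 0).le _)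
  dsimp only
  split_ifs
  · exact le_rfl
  · rw [inner_zero_left]; exact real_inner_self_nonneg

/-- `‖(1 − χ)f‖ ≤ ‖f‖` for `0 ≤ χ ≤ 1`. [cite: Balaban1982Higgs1, (1.5) p.604] -/
theorem sqrt_siteInner_oneSub_le (χ : HiggsLattice.Site P 0 → ℝ) (hχ0 : ∀ x, 0 ≤ χ x) (hχ1 : ∀ x, χ x ≤ 1)
    (f : ScalarField P 0 N) :
    Real.sqrt (siteInner (fun x => (1 - χ x) • f x) (fun x => (1 - χ x) • f x)) ≤ Real.sqrt (siteInner f f) := by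
  refine Real.sqrt_le_sqrt ?_
  unfold siteInner
  refine Finset.sum_le_sum fun x _ => mul_le_mul_of_nonneg_left ?_ (pow_nonneg (P.mesh_pos 0).le _)
  rw [real_inner_smul_left, real_inner_smul_right, real_inner_self_eq_norm_sq]
  have h0 : 0 ≤ 1 - χ x := by linarith [hχ1 x]
  have h1 : 1 - χ x ≤ 1 := by linarith [hχ0 x]
  have hn : 0 ≤ ‖f x‖ ^ 2 := sq_nonneg _
  calc (1 - χ x) * ((1 - χ x) * ‖f x‖ ^ 2) ≤ 1 * (1 * ‖f x‖ ^ 2) :=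
        mul_le_mul h1 (mul_le_mul_of_nonneg_right h1 hn) (by positivity) zero_le_one
    _ = ‖f x‖ ^ 2 := by ring

/-- `D^{ε*}_A0 = 0`. [cite: Balaban1982Higgs1, (1.7) p.605] -/
theorem adjA_zero : adjA C A (0 : HiggsLattice.PBond P 0 → E N) = 0 := by
  funext x
  simp [adjA]

/-- **`‖m‖² ≤ (κε^{−1})²·d·‖h′‖²`** for the jump field `m(x) = ε^{−1}Σ_ν(χ(x + εe_ν) − χ(x))h′(⟨x, ν⟩)` when `|χ(b₊) − χ(b₋)| ≤ κ` on every bond.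
[cite: Balaban1982Higgs1, (1.5) p.604] -/
theorem siteInner_jumpField_le (χ : HiggsLattice.Site P 0 → ℝ) {κ : ℝ} (hκ0 : 0 ≤ κ)
    (hκ : ∀ b : HiggsLattice.PBond P 0, |χ b.tgt - χ b.src| ≤ κ) (h' : HiggsLattice.PBond P 0 → E N) :
    siteInner (fun x => (P.mesh 0)⁻¹ • ∑ ν : Fin P.d, (χ (x.shift ν) - χ x) • h' ⟨x, ν⟩)
        (fun x => (P.mesh 0)⁻¹ • ∑ ν : Fin P.d, (χ (x.shift ν) - χ x) • h' ⟨x, ν⟩)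
      ≤ (κ * (P.mesh 0)⁻¹) ^ 2 * P.d * bondInner h' h' := by
  have hm0 : 0 < P.mesh 0 := P.mesh_pos 0
  have hmd : 0 ≤ P.mesh 0 ^ P.d := pow_nonneg hm0.le _
  rw [siteInner_self_eq]
  -- pointwise bound
  have hpt : ∀ x : HiggsLattice.Site P 0,
      ‖(P.mesh 0)⁻¹ • ∑ ν : Fin P.d, (χ (x.shift ν) - χ x) • h' ⟨x, ν⟩‖ ^ 2
        ≤ (κ * (P.mesh 0)⁻¹) ^ 2 * P.d * ∑ ν : Fin P.d, ‖h' ⟨x, ν⟩‖ ^ 2 := by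
    intro x
    have h1 : ‖∑ ν : Fin P.d, (χ (x.shift ν) - χ x) • h' ⟨x, ν⟩‖ ≤ ∑ ν : Fin P.d, κ * ‖h' ⟨x, ν⟩‖ := by
      refine (norm_sum_le _ _).trans (Finset.sum_le_sum fun ν _ => ?_)
      rw [norm_smul, Real.norm_eq_abs]
      exact mul_le_mul_of_nonneg_right (hκ ⟨x, ν⟩) (norm_nonneg _)
    have h2 : (∑ ν : Fin P.d, κ * ‖h' ⟨x, ν⟩‖) ^ 2 ≤ P.d * ∑ ν : Fin P.d, (κ * ‖h' ⟨x, ν⟩‖) ^ 2 := by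
      have := Finset.sum_mul_sq_le_sq_mul_sq (Finset.univ : Finset (Fin P.d)) (fun _ => (1 : ℝ)) (fun ν => κ * ‖h' ⟨x, ν⟩‖)
      simp only [one_pow, Finset.sum_const, Finset.card_univ, Fintype.card_fin, nsmul_eq_mul, mul_one, one_mul] at this
      exact this
    have h3 : ∑ ν : Fin P.d, (κ * ‖h' ⟨x, ν⟩‖) ^ 2 = κ ^ 2 * ∑ ν : Fin P.d, ‖h' ⟨x, ν⟩‖ ^ 2 := by
      rw [Finset.mul_sum]; exact Finset.sum_congr rfl fun ν _ => by ring
    have h0 : 0 ≤ ∑ ν : Fin P.d, κ * ‖h' ⟨x, ν⟩‖ := Finset.sum_nonneg fun ν _ => by positivity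
    rw [norm_smul, Real.norm_eq_abs, abs_of_pos (inv_pos.2 hm0), mul_pow]
    calc (P.mesh 0)⁻¹ ^ 2 * ‖∑ ν : Fin P.d, (χ (x.shift ν) - χ x) • h' ⟨x, ν⟩‖ ^ 2
        ≤ (P.mesh 0)⁻¹ ^ 2 * (∑ ν : Fin P.d, κ * ‖h' ⟨x, ν⟩‖) ^ 2 :=
          mul_le_mul_of_nonneg_left (pow_le_pow_left₀ (norm_nonneg _) h1 2) (sq_nonneg _)
      _ ≤ (P.mesh 0)⁻¹ ^ 2 * (P.d * (κ ^ 2 * ∑ ν : Fin P.d, ‖h' ⟨x, ν⟩‖ ^ 2)) := by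
          rw [← h3]; exact mul_le_mul_of_nonneg_left h2 (sq_nonneg _)
      _ = _ := by ring
  have hbond : bondInner h' h' = ∑ x : HiggsLattice.Site P 0, ∑ ν : Fin P.d, P.mesh 0 ^ P.d * ‖h' ⟨x, ν⟩‖ ^ 2 := by
    unfold bondInner
    rw [sum_site_dir (fun x ν => P.mesh 0 ^ P.d * ‖h' ⟨x, ν⟩‖ ^ 2)]
    exact Finset.sum_congr rfl fun b _ => by rw [real_inner_self_eq_norm_sq]
  rw [hbond, Finset.mul_sum]
  refine Finset.sum_le_sum fun x _ => ?_
  rw [← Finset.mul_sum]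
  calc P.mesh 0 ^ P.d * ‖(P.mesh 0)⁻¹ • ∑ ν : Fin P.d, (χ (x.shift ν) - χ x) • h' ⟨x, ν⟩‖ ^ 2
      ≤ P.mesh 0 ^ P.d * ((κ * (P.mesh 0)⁻¹) ^ 2 * P.d * ∑ ν : Fin P.d, ‖h' ⟨x, ν⟩‖ ^ 2) :=
        mul_le_mul_of_nonneg_left (hpt x) hmd
    _ = _ := by ring

/-- support of the jump field: `m(x) ≠ 0 ⇒ χ(x + εe_ν) ≠ χ(x)` and `h′(⟨x, ν⟩) ≠ 0` for some `ν`. [folklore] -/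
private theorem exists_of_jumpField_ne_zero (χ : HiggsLattice.Site P 0 → ℝ) (h' : HiggsLattice.PBond P 0 → E N) {x : HiggsLattice.Site P 0}
    (hx : ((P.mesh 0)⁻¹ • ∑ ν : Fin P.d, (χ (x.shift ν) - χ x) • h' ⟨x, ν⟩) ≠ 0) :
    ∃ ν : Fin P.d, χ (x.shift ν) ≠ χ x ∧ h' ⟨x, ν⟩ ≠ 0 := by
  have hsum : ∑ ν : Fin P.d, (χ (x.shift ν) - χ x) • h' ⟨x, ν⟩ ≠ 0 := fun h0 => hx (by rw [h0, smul_zero])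
  obtain ⟨ν, -, hν⟩ := Finset.exists_ne_zero_of_sum_ne_zero hsum
  refine ⟨ν, ?_, ?_⟩
  · intro h; exact hν (by rw [h, sub_self, zero_smul])
  · intro h; exact hν (by rw [h, smul_zero])

/-- the jump sum: `|Σ_b ε^d·ε^{−1}(χ(b₊)−χ(b₋))⟪h(b), u(b₋)⟫| ≤ κε^{−1}Σ_{b∈S} ε^d‖h(b)‖‖u(b₋)‖` when every bond where `h ≠ 0` and `χ` jumps is in
`S`. [folklore] -/
private theorem abs_sum_jump_le (χ : HiggsLattice.Site P 0 → ℝ) {κ : ℝ} (hκ0 : 0 ≤ κ)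
    (hκ : ∀ b : HiggsLattice.PBond P 0, |χ b.tgt - χ b.src| ≤ κ) (S : Finset (HiggsLattice.PBond P 0))
    (h : HiggsLattice.PBond P 0 → E N) (hhS : ∀ b, h b ≠ 0 → χ b.tgt ≠ χ b.src → b ∈ S) (u : ScalarField P 0 N) :
    |∑ b : HiggsLattice.PBond P 0, P.mesh 0 ^ P.d * (((P.mesh 0)⁻¹ * (χ b.tgt - χ b.src)) * ⟪h b, u b.src⟫_ℝ)|
      ≤ κ * (P.mesh 0)⁻¹ * ∑ b ∈ S, P.mesh 0 ^ P.d * (‖h b‖ * ‖u b.src‖) := by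
  classical
  have hm0 : 0 < P.mesh 0 := P.mesh_pos 0
  have hmd : 0 < P.mesh 0 ^ P.d := pow_pos hm0 _
  have hterm : ∀ b : HiggsLattice.PBond P 0,
      |P.mesh 0 ^ P.d * (((P.mesh 0)⁻¹ * (χ b.tgt - χ b.src)) * ⟪h b, u b.src⟫_ℝ)|
        ≤ if b ∈ S then κ * (P.mesh 0)⁻¹ * (P.mesh 0 ^ P.d * (‖h b‖ * ‖u b.src‖)) else 0 := by
    intro b
    by_cases hd : χ b.tgt = χ b.src
    · rw [hd, sub_self, mul_zero, zero_mul, mul_zero, abs_zero]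
      split_ifs <;> positivity
    · by_cases hb : h b = 0
      · rw [hb, inner_zero_left, mul_zero, mul_zero, abs_zero]
        split_ifs <;> positivity
      · rw [if_pos (hhS b hb hd), abs_mul, abs_of_pos hmd, abs_mul, abs_mul, abs_of_pos (inv_pos.2 hm0)]
        have h1 : |⟪h b, u b.src⟫_ℝ| ≤ ‖h b‖ * ‖u b.src‖ := abs_real_inner_le_norm _ _
        have h2 := hκ b
        calc P.mesh 0 ^ P.d * ((P.mesh 0)⁻¹ * |χ b.tgt - χ b.src| * |⟪h b, u b.src⟫_ℝ|)
            ≤ P.mesh 0 ^ P.d * ((P.mesh 0)⁻¹ * κ * (‖h b‖ * ‖u b.src‖)) := by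
              refine mul_le_mul_of_nonneg_left ?_ hmd.le
              exact mul_le_mul (mul_le_mul_of_nonneg_left h2 (inv_pos.2 hm0).le) h1 (abs_nonneg _) (by positivity)
          _ = _ := by ring
  calc _ ≤ ∑ b : HiggsLattice.PBond P 0, |P.mesh 0 ^ P.d * (((P.mesh 0)⁻¹ * (χ b.tgt - χ b.src)) * ⟪h b, u b.src⟫_ℝ)| :=
        Finset.abs_sum_le_sum_abs _ _
    _ ≤ ∑ b : HiggsLattice.PBond P 0, (if b ∈ S then κ * (P.mesh 0)⁻¹ * (P.mesh 0 ^ P.d * (‖h b‖ * ‖u b.src‖)) else 0) :=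
        Finset.sum_le_sum fun b _ => hterm b
    _ = _ := by rw [← Finset.sum_filter, Finset.filter_mem_eq_inter, Finset.univ_inter, Finset.mul_sum]

/-- if a bond pairing is nonzero then the first factor is nonzero at some bond. [folklore] -/
private theorem exists_of_bondInner_ne_zero (φ g : HiggsLattice.PBond P 0 → E N) (h : bondInner φ g ≠ 0) : ∃ b, φ b ≠ 0 := by
  by_contra hne
  apply h
  unfold bondInner
  refine Finset.sum_eq_zero fun b _ => ?_
  have hb : φ b = 0 := by
    by_contra hb
    exact hne ⟨b, hb⟩
  rw [hb, inner_zero_left, mul_zero]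

end Leibniz

/-! ## §4 The three derivative `δG_k(Ω,Ω₀,A)` pairings from a coercivity constant and an adapted cutoff -/

section Assembly

variable (C : ChargeData N) (A : HiggsLattice.VecField P 0) {msq a : ℝ}

/-- shifted exponential: `e^{−δ(ρ−1)/L^k} ≤ e^{δ}e^{−δρ/L^k}` (`δ ≥ 0`, `L^k ≥ 1`). [folklore] -/
private theorem exp_shift_one {δ Lk : ℝ} (hδ0 : 0 ≤ δ) (hLk : 1 ≤ Lk) (ρ : ℝ) :
    Real.exp (-(δ * ((ρ - 1) / Lk))) ≤ Real.exp δ * Real.exp (-(δ * (ρ / Lk))) := by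
  have hLpos : 0 < Lk := by linarith
  rw [← Real.exp_add]
  apply Real.exp_le_exp.2
  have h1 : δ * ((ρ - 1) / Lk) = δ * (ρ / Lk) - δ / Lk := by
    rw [sub_div, mul_sub, mul_one_div]
  have h2 : δ / Lk ≤ δ := div_le_self hδ0 hLk
  linarith

/-- shifted exponential: `e^{−δ(ρ−2)/L^k} ≤ e^{2δ}e^{−δρ/L^k}`. [folklore] -/
private theorem exp_shift_two {δ Lk : ℝ} (hδ0 : 0 ≤ δ) (hLk : 1 ≤ Lk) (ρ : ℝ) :
    Real.exp (-(δ * ((ρ - 2) / Lk))) ≤ Real.exp δ ^ 2 * Real.exp (-(δ * (ρ / Lk))) := by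
  have hLpos : 0 < Lk := by linarith
  rw [← Real.exp_nat_mul, ← Real.exp_add]
  apply Real.exp_le_exp.2
  have h1 : δ * ((ρ - 2) / Lk) = δ * (ρ / Lk) - 2 * (δ / Lk) := by
    rw [sub_div, mul_sub]; ring
  have h2 : δ / Lk ≤ δ := div_le_self hδ0 hLk
  push_cast
  linarith

/-- `ρ ≤ 1 ⇒ 1 ≤ e^{δ}e^{−δρ/L^k}`. [folklore] -/
private theorem one_le_exp_mul_of_le_one {δ Lk : ℝ} (hδ0 : 0 ≤ δ) (hLk : 1 ≤ Lk) {ρ : ℝ} (hρ : ρ ≤ 1) :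
    1 ≤ Real.exp δ * Real.exp (-(δ * (ρ / Lk))) := by
  have hLpos : 0 < Lk := by linarith
  rw [← Real.exp_add]
  apply Real.one_le_exp
  have h1 : ρ / Lk ≤ 1 := by rw [div_le_one hLpos]; linarith
  nlinarith

/-- `ρ ≤ 0 ⇒ 1 ≤ e^{−δρ/L^k}`. [folklore] -/
private theorem one_le_exp_of_le_zero {δ Lk : ℝ} (hδ0 : 0 ≤ δ) (hLk : 1 ≤ Lk) {ρ : ℝ} (hρ : ρ ≤ 0) :
    1 ≤ Real.exp (-(δ * (ρ / Lk))) := by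
  have hLpos : 0 < Lk := by linarith
  apply Real.one_le_exp
  have : δ * (ρ / Lk) ≤ 0 := mul_nonpos_of_nonneg_of_nonpos hδ0 (div_nonpos_of_nonpos_of_nonneg hρ hLpos.le)
  linarith

/-- `|b₋ − b₊| ≤ 1` in the real form. [cite: Balaban1982Higgs1, (1.3)–(1.4) p.604] -/
private theorem tdist_src_tgt_le_one (b : HiggsLattice.PBond P 0) : (HiggsLattice.Site.tdist b.src b.tgt : ℝ) ≤ 1 := by
  exact_mod_cast tdist_shift_le_one b.src b.dir

set_option maxHeartbeats 1600000 in
/-- **THE SECOND `δG_k(Ω,Ω₀,A)` PAIRING `⟨h, D^ε_A(G^ε_k(Ω,A) − G^ε_k(Ω₀,A))g′⟩` FROM A COERCIVITY CONSTANT AND AN ADAPTED CUTOFF** ([13] (1.11) /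
(2.30) second sentence, `L²` version, on the concrete carrier).  Data as in `B1DeltaGRegularRegion.deltaG_pairing_of_cutoff` (`Ω ⊆ Ω₀` unions of
`k`-blocks; coercivity `γ` of (2.20) at `A` on the `Ω`- and the `Ω₀`-supported fields; admissible `δ`; cutoff `0 ≤ χ ≤ 1` vanishing at both ends of
the bonds of `Ω₀` not inside `Ω`, bond jumps `≤ κ`, block oscillation `≤ κ′`, constant on the blocks outside `Y`; jump bonds `S ⊂ Ω`; transition set
`T ⊇ {x ∈ Ω : χ ≠ 1} ∪ src S ∪ B^k(Y)`); a bond field `h` vanishing off the bonds inside `Ω` whose sources are at lattice distance `≥ r` from `T`, a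
site field `g′ ⊂ Ω` at distance `≥ r′` from `T`.  Then `|⟨h, D^ε_A(G^ε_k(Ω,A) − G^ε_k(Ω₀,A))g′⟩| ≤ C₁·(L^kε)·e^{−δr/L^k}e^{−δr′/L^k}‖h‖‖g′‖` with
`C₁ = c_D(e^{δ} + e^{3δ}) + κε^{−1}(L^kε)√d(e^{2δ}(c₂·2/γ + c_D²) + 2/γ) + 2κ′a_kc_De^{δ}·2/γ`, `c_D = 2/√γ + 4√d·δ/γ`, `c₂ = 4 + 2δ(8d/γ)^{1/2}` — with
`κ = 1/(ML^k)`, `κ′ = 1/M` uniform in `k`, one power of `L^kε` as for the plain second pairing. [cite: Balaban1983RegularityDecay, (1.11) p.573, Cor. 2.3 (2.30) pp.580–581] -/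
theorem deltaG_pairing_DG_of_cutoff (hk : k ≤ P.K) (Ω Ω₀ : Finset (HiggsLattice.Site P 0))
    (hΩ : ∀ x x' : HiggsLattice.Site P 0, blockIter k x = blockIter k x' → (x ∈ Ω ↔ x' ∈ Ω))
    (hΩ₀ : ∀ x x' : HiggsLattice.Site P 0, blockIter k x = blockIter k x' → (x ∈ Ω₀ ↔ x' ∈ Ω₀)) (hsub : Ω ⊆ Ω₀)
    (hmsq : 0 < msq) (hak : 0 ≤ B1.aSeq a P.L k) {γ : ℝ} (hγ : 0 < γ)
    (hlow : ∀ w : ScalarField P 0 N, (∀ x, x ∉ Ω → w x = 0) →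
      γ * ((P.mesh k)⁻¹ ^ 2) * siteInner w w ≤ siteInner w (covOpK C Ω A msq a k w))
    (hlow₀ : ∀ w : ScalarField P 0 N, (∀ x, x ∉ Ω₀ → w x = 0) →
      γ * ((P.mesh k)⁻¹ ^ 2) * siteInner w w ≤ siteInner w (covOpK C Ω₀ A msq a k w))
    {δ : ℝ} (hδ0 : 0 ≤ δ) (hδ1 : δ ≤ 1) (hδ : 2 * (2 * P.d * δ ^ 2 + B1.aSeq a P.L k * (2 * δ)) ≤ γ)
    (χ : HiggsLattice.Site P 0 → ℝ) (hχ0 : ∀ x, 0 ≤ χ x) (hχ1 : ∀ x, χ x ≤ 1)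
    (hχbd : ∀ b : HiggsLattice.PBond P 0, Inside Ω₀ b → ¬ Inside Ω b → χ b.src = 0 ∧ χ b.tgt = 0)
    {κ : ℝ} (hκ0 : 0 ≤ κ) (hκ : ∀ b : HiggsLattice.PBond P 0, |χ b.tgt - χ b.src| ≤ κ)
    (S : Finset (HiggsLattice.PBond P 0)) (hSin : ∀ b ∈ S, Inside Ω b) (hS : ∀ b, Inside Ω b → χ b.tgt ≠ χ b.src → b ∈ S)
    {κ' : ℝ} (hκ'0 : 0 ≤ κ') (hosc : ∀ x x' : HiggsLattice.Site P 0, blockIter k x = blockIter k x' → |χ x - χ x'| ≤ κ')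
    (Y : Finset (HiggsLattice.Site P k))
    (hY : ∀ x x' : HiggsLattice.Site P 0, blockIter k x = blockIter k x' → blockIter k x ∉ Y → χ x = χ x')
    (T : Finset (HiggsLattice.Site P 0)) (hTχ : ∀ x, x ∈ Ω → χ x ≠ 1 → x ∈ T) (hTS : ∀ b ∈ S, b.src ∈ T)
    (hTY : ∀ x, blockIter k x ∈ Y → x ∈ T)
    (h : HiggsLattice.PBond P 0 → E N) (hh : ∀ b, ¬ Inside Ω b → h b = 0)
    (g' : ScalarField P 0 N) (hg' : ∀ x, x ∉ Ω → g' x = 0) (r r' : ℝ)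
    (hr : ∀ (b : HiggsLattice.PBond P 0) (t : HiggsLattice.Site P 0), h b ≠ 0 → t ∈ T → r ≤ (HiggsLattice.Site.tdist b.src t : ℝ))
    (hr' : ∀ x t, g' x ≠ 0 → t ∈ T → r' ≤ (HiggsLattice.Site.tdist x t : ℝ)) :
    |bondInner h (covDeriv C A (propagatorK C Ω A msq a k g')) - bondInner h (covDeriv C A (propagatorK C Ω₀ A msq a k g'))|
      ≤ ((2 / Real.sqrt γ + 4 * Real.sqrt P.d * δ / γ) * (Real.exp δ + Real.exp δ ^ 3)
          + κ * (P.mesh 0)⁻¹ * P.mesh k * Real.sqrt P.d *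
              (Real.exp δ ^ 2 * ((4 + 2 * δ * Real.sqrt (8 * P.d / γ)) * (2 / γ) + (2 / Real.sqrt γ + 4 * Real.sqrt P.d * δ / γ) ^ 2)
                + 2 / γ)
          + 2 * κ' * B1.aSeq a P.L k * (2 / Real.sqrt γ + 4 * Real.sqrt P.d * δ / γ) * Real.exp δ * (2 / γ))
        * P.mesh k * Real.exp (-(δ * (r / (P.L : ℝ) ^ k))) * Real.exp (-(δ * (r' / (P.L : ℝ) ^ k)))
        * Real.sqrt (bondInner h h) * Real.sqrt (siteInner g' g') := by
  classical
  have hM : 0 < P.mesh k := P.mesh_pos k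
  have hm0 : 0 < P.mesh 0 := P.mesh_pos 0
  have hLk : (1 : ℝ) ≤ (P.L : ℝ) ^ k := by exact_mod_cast Nat.one_le_pow _ _ P.hL
  have hLpos : (0 : ℝ) < (P.L : ℝ) ^ k := by linarith
  have hg'₀ : ∀ x, x ∉ Ω₀ → g' x = 0 := fun x hx => hg' x (fun h0 => hx (hsub h0))
  have hh₀ : ∀ b, ¬ Inside Ω₀ b → h b = 0 := fun b hb => hh b (fun hin => hb ⟨hsub hin.1, hsub hin.2⟩)
  have hSin₀ : ∀ b ∈ S, Inside Ω₀ b := fun b hb => ⟨hsub (hSin b hb).1, hsub (hSin b hb).2⟩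
  -- abbreviations
  set cD := 2 / Real.sqrt γ + 4 * Real.sqrt P.d * δ / γ with hcD
  set c₂ := 4 + 2 * δ * Real.sqrt (8 * P.d / γ) with hc₂
  set E₁ := Real.exp δ with hE₁
  have hcD0 : 0 ≤ cD := by positivity
  have hc₂0 : 0 ≤ c₂ := by positivity
  have hE₁0 : 0 < E₁ := Real.exp_pos δ
  set ef := Real.exp (-(δ * (r / (P.L : ℝ) ^ k))) with hef
  set ef' := Real.exp (-(δ * (r' / (P.L : ℝ) ^ k))) with hef'
  have hef0 : 0 < ef := Real.exp_pos _
  have hef'0 : 0 < ef' := Real.exp_pos _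
  set nh := Real.sqrt (bondInner h h) with hnh
  set ng' := Real.sqrt (siteInner g' g') with hng'
  have hnh0 : 0 ≤ nh := Real.sqrt_nonneg _
  have hng'0 : 0 ≤ ng' := Real.sqrt_nonneg _
  -- the test site field g = D^{ε*}_A h and the conversion of the bond pairings
  set g : ScalarField P 0 N := adjA C A h with hg
  have hconv : ∀ (Ω' : Finset (HiggsLattice.Site P 0)) (φ : ScalarField P 0 N),
      siteInner g (propagatorK C Ω' A msq a k φ) = bondInner h (covDeriv C A (propagatorK C Ω' A msq a k φ)) := by
    intro Ω' φ
    rw [siteInner_comm, hg, siteInner_adjA, bondInner_comm]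
  rw [← hconv Ω g', ← hconv Ω₀ g', deltaG_split C A Ω Ω₀ hmsq hak χ g g']
  set v : ScalarField P 0 N := propagatorK C Ω A msq a k g with hv
  set u₀ : ScalarField P 0 N := propagatorK C Ω₀ A msq a k g' with hu₀
  ---------------------------------------------------------------- separations
  set SY : Finset (HiggsLattice.Site P 0) := Finset.univ.filter fun x => blockIter k x ∈ Y with hSY
  have hSYT : ∀ x ∈ SY, x ∈ T := fun x hx => hTY x (Finset.mem_filter.1 hx).2
  have hYeq : ∀ w : ScalarField P 0 N, (fun x => if blockIter k x ∈ Y then w x else 0) = fun x => if x ∈ SY then w x else 0 := by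
    intro w; funext x
    simp only [hSY, Finset.mem_filter, Finset.mem_univ, true_and]
  have hsepTv : ∀ b : HiggsLattice.PBond P 0, h b ≠ 0 → ∀ t ∈ T, r ≤ (HiggsLattice.Site.tdist b.src t : ℝ) :=
    fun b hb t ht => hr b t hb ht
  have hsepYv : ∀ b : HiggsLattice.PBond P 0, h b ≠ 0 → ∀ t ∈ SY, r ≤ (HiggsLattice.Site.tdist b.src t : ℝ) :=
    fun b hb t ht => hr b t hb (hSYT t ht)
  have hsepSv : ∀ B ∈ S, ∀ b : HiggsLattice.PBond P 0, h b ≠ 0 →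
      r - 1 ≤ (HiggsLattice.Site.tdist B.src b.src : ℝ) ∧ r - 1 ≤ (HiggsLattice.Site.tdist B.src b.tgt : ℝ) := by
    intro B hB b hb
    have h1 : r ≤ (HiggsLattice.Site.tdist b.src B.src : ℝ) := hr b B.src hb (hTS B hB)
    rw [tdist_comm] at h1
    have h2 := tdist_triangle_real B.src b.tgt b.src
    have h3 : (HiggsLattice.Site.tdist b.tgt b.src : ℝ) ≤ 1 := by rw [tdist_comm]; exact tdist_src_tgt_le_one b
    constructor <;> linarith
  have hsepTu : ∀ x ∈ T, ∀ x', g' x' ≠ 0 → r' ≤ (HiggsLattice.Site.tdist x x' : ℝ) := by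
    intro x hx x' hx'
    have h0 := hr' x' x hx' hx
    rwa [tdist_comm] at h0
  have hsepSu : ∀ b ∈ S, ∀ x', g' x' ≠ 0 → r' ≤ (HiggsLattice.Site.tdist b.src x' : ℝ) :=
    fun b hb x' hx' => hsepTu b.src (hTS b hb) x' hx'
  have hsepYu : ∀ x ∈ SY, ∀ x', g' x' ≠ 0 → r' ≤ (HiggsLattice.Site.tdist x x' : ℝ) :=
    fun x hx x' hx' => hsepTu x (hSYT x hx) x' hx'
  ---------------------------------------------------------------- the six restricted norms
  have nTv := restricted_norm_GDt_le C A hk Ω hΩ hmsq hak hγ hlow hδ0 hδ1 hδ T h hh r hsepTv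
  have nSv := restricted_norm_DGDt_le C A hk Ω hΩ hmsq hak hγ hlow hδ0 hδ1 hδ S hSin h hh (r - 1) hsepSv
  have nYv := restricted_norm_GDt_le C A hk Ω hΩ hmsq hak hγ hlow hδ0 hδ1 hδ SY h hh r hsepYv
  have nTu := restricted_norm_G_le C A hk Ω₀ hΩ₀ hmsq hak hγ hlow₀ hδ0 hδ1 hδ T g' hg'₀ r' hsepTu
  have nSu := restricted_norm_DG_le C A hk Ω₀ hΩ₀ hmsq hak hγ hlow₀ hδ0 hδ1 hδ S hSin₀ g' r' hsepSu
  have nYu := restricted_norm_G_le C A hk Ω₀ hΩ₀ hmsq hak hγ hlow₀ hδ0 hδ1 hδ SY g' hg'₀ r' hsepYu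
  rw [← hg, ← hv] at nTv nSv nYv
  rw [← hu₀] at nTu nSu nYu
  have hA₁ : Real.sqrt (siteInner (fun x => if x ∈ T then v x else 0) (fun x => if x ∈ T then v x else 0))
      ≤ cD * P.mesh k * E₁ * ef * nh := nTv
  have hA₂ : Real.sqrt (bondInner (fun b => if b ∈ S then covDeriv C A v b else 0) (fun b => if b ∈ S then covDeriv C A v b else 0))
      ≤ c₂ * E₁ ^ 2 * ef * nh := by
    refine nSv.trans ?_
    have s1 := exp_shift_one hδ0 hLk r
    calc c₂ * E₁ * Real.exp (-(δ * ((r - 1) / (P.L : ℝ) ^ k))) * nh = (c₂ * E₁ * nh) * Real.exp (-(δ * ((r - 1) / (P.L : ℝ) ^ k))) := by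
          ring
      _ ≤ (c₂ * E₁ * nh) * (E₁ * ef) := mul_le_mul_of_nonneg_left s1 (by positivity)
      _ = c₂ * E₁ ^ 2 * ef * nh := by ring
  have hA₃ : Real.sqrt (siteInner (fun x => if blockIter k x ∈ Y then v x else 0) (fun x => if blockIter k x ∈ Y then v x else 0))
      ≤ cD * P.mesh k * E₁ * ef * nh := by rw [hYeq]; exact nYv
  have hB₁ : Real.sqrt (siteInner (fun x => if x ∈ T then u₀ x else 0) (fun x => if x ∈ T then u₀ x else 0))
      ≤ 2 / γ * P.mesh k ^ 2 * ef' * ng' := nTu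
  have hB₂ : Real.sqrt (bondInner (fun b => if b ∈ S then covDeriv C A u₀ b else 0) (fun b => if b ∈ S then covDeriv C A u₀ b else 0))
      ≤ cD * P.mesh k * E₁ * ef' * ng' := nSu
  have hB₃ : Real.sqrt (siteInner (fun x => if blockIter k x ∈ Y then u₀ x else 0) (fun x => if blockIter k x ∈ Y then u₀ x else 0))
      ≤ 2 / γ * P.mesh k ^ 2 * ef' * ng' := by rw [hYeq]; exact nYu
  ---------------------------------------------------------------- the commutator term
  have hcomm := commutator_le C A hk Ω Ω₀ hsub hak χ hχbd hκ0 hκ S hS hκ'0 hosc Y hY T hTS v u₀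
    (a₁ := cD * P.mesh k * E₁ * ef * nh) (a₂ := c₂ * E₁ ^ 2 * ef * nh) (a₃ := cD * P.mesh k * E₁ * ef * nh)
    (b₁ := 2 / γ * P.mesh k ^ 2 * ef' * ng') (b₂ := cD * P.mesh k * E₁ * ef' * ng') (b₃ := 2 / γ * P.mesh k ^ 2 * ef' * ng')
    (by positivity) (by positivity) hA₁ hA₂ hA₃ hB₁ hB₂ hB₃
  have hcomm' : |(siteInner v (covLaplacianN C Ω A (fun x => χ x • u₀ x)) - siteInner (fun x => χ x • v x) (covLaplacianN C Ω₀ A u₀))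
        + B1.aSeq a P.L k * ((P.mesh k)⁻¹ ^ 2) *
          (siteInner v (projPk C A k (fun x => χ x • u₀ x)) - siteInner (fun x => χ x • v x) (projPk C A k u₀))|
      ≤ (κ * (P.mesh 0)⁻¹ * P.mesh k * Real.sqrt P.d * (E₁ ^ 2 * (c₂ * (2 / γ) + cD ^ 2))
          + 2 * κ' * B1.aSeq a P.L k * cD * E₁ * (2 / γ)) * P.mesh k * ef * ef' * nh * ng' := by
    refine hcomm.trans (le_of_eq ?_)
    field_simp
  ---------------------------------------------------------------- boundary term (B): ⟨g, G_Ω((1−χ)g′)⟩ = ⟨h, D_AG_Ω((1−χ)g′)⟩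
  have hB : |siteInner g (propagatorK C Ω A msq a k (fun x => (1 - χ x) • g' x))| ≤ cD * E₁ * P.mesh k * ef * ef' * nh * ng' := by
    rw [hconv Ω]
    by_cases hB0 : (fun x => (1 - χ x) • g' x) = 0
    · rw [hB0, map_zero]
      have hz : bondInner h (covDeriv C A (0 : ScalarField P 0 N)) = 0 := by
        unfold bondInner
        refine Finset.sum_eq_zero fun b _ => ?_
        rw [covDeriv_eq]; simp
      rw [hz, abs_zero]; positivity
    · obtain ⟨x₁, hx₁⟩ : ∃ x, (fun x => (1 - χ x) • g' x) x ≠ 0 := by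
        by_contra hne
        push Not at hne
        exact hB0 (funext fun x => hne x)
      have hfx₁ : g' x₁ ≠ 0 := by intro h0; exact hx₁ (by simp only [h0, smul_zero])
      have hχx₁ : χ x₁ ≠ 1 := by intro h0; exact hx₁ (by simp only [h0, sub_self, zero_smul])
      have hxΩ : x₁ ∈ Ω := by by_contra h0; exact hfx₁ (hg' x₁ h0)
      have hr'_le : r' ≤ 0 := by
        have h0 := hr' x₁ x₁ hfx₁ (hTχ x₁ hxΩ hχx₁)
        rw [tdist_self] at h0; exact_mod_cast h0
      have hef'1 : 1 ≤ ef' := one_le_exp_of_le_zero hδ0 hLk hr'_le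
      have hsuppB : ∀ x, x ∉ Ω → (fun x => (1 - χ x) • g' x) x = 0 := fun x hx => by simp only [hg' x hx, smul_zero]
      have hsepB : ∀ (b : HiggsLattice.PBond P 0) (x' : HiggsLattice.Site P 0), h b ≠ 0 → (fun x => (1 - χ x) • g' x) x' ≠ 0 →
          r ≤ (HiggsLattice.Site.tdist b.src x' : ℝ) := by
        intro b x' hb hx'
        have hfx' : g' x' ≠ 0 := by intro h0; exact hx' (by simp only [h0, smul_zero])
        have hχx' : χ x' ≠ 1 := by intro h0; exact hx' (by simp only [h0, sub_self, zero_smul])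
        have hxΩ' : x' ∈ Ω := by by_contra h0; exact hfx' (hg' x' h0)
        exact hr b x' hb (hTχ x' hxΩ' hχx')
      have hp := pairing_DG_of_coercive C A hk Ω hΩ hmsq hak hγ hlow hδ0 hδ1 hδ h hh _ hsuppB r hsepB
      have hn := sqrt_siteInner_oneSub_le χ hχ0 hχ1 g'
      calc _ ≤ _ := hp
        _ ≤ cD * P.mesh k * E₁ * ef * nh * ng' := mul_le_mul_of_nonneg_left hn (by positivity)
        _ = 1 * (cD * P.mesh k * E₁ * ef * nh * ng') := by ring
        _ ≤ ef' * (cD * P.mesh k * E₁ * ef * nh * ng') := mul_le_mul_of_nonneg_right hef'1 (by positivity)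
        _ = cD * E₁ * P.mesh k * ef * ef' * nh * ng' := by ring
  ---------------------------------------------------------------- boundary term (A): ⟨(1−χ)g, u₀⟩ = ⟨h, D_A((1−χ)u₀)⟩
  have hA : |siteInner (fun x => (1 - χ x) • g x) u₀|
      ≤ (cD * E₁ ^ 3 + κ * (P.mesh 0)⁻¹ * P.mesh k * Real.sqrt P.d * (2 / γ)) * P.mesh k * ef * ef' * nh * ng' := by
    have e1 : siteInner (fun x => (1 - χ x) • g x) u₀ = bondInner h (covDeriv C A (fun x => (1 - χ x) • u₀ x)) := by
      rw [← siteInner_smulFun_comm (fun x => 1 - χ x) g u₀, siteInner_comm, hg, siteInner_adjA, bondInner_comm]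
    rw [e1, bondInner_covDeriv_oneSub]
    -- (A1)
    have hA1 : |bondInner (fun b => (1 - χ b.tgt) • h b) (covDeriv C A u₀)| ≤ cD * E₁ ^ 3 * P.mesh k * ef * ef' * nh * ng' := by
      by_cases hA10 : bondInner (fun b => (1 - χ b.tgt) • h b) (covDeriv C A u₀) = 0
      · rw [hA10, abs_zero]; positivity
      · obtain ⟨b₁, hb₁⟩ := exists_of_bondInner_ne_zero _ _ hA10
        have hhb₁ : h b₁ ≠ 0 := by intro h0; exact hb₁ (by simp only [h0, smul_zero])
        have hχb₁ : χ b₁.tgt ≠ 1 := by intro h0; exact hb₁ (by simp only [h0, sub_self, zero_smul])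
        have hin : Inside Ω b₁ := by by_contra h0; exact hhb₁ (hh b₁ h0)
        have hr1 : r ≤ 1 := by
          have h0 := hr b₁ b₁.tgt hhb₁ (hTχ _ hin.2 hχb₁)
          have h1 := tdist_src_tgt_le_one b₁
          linarith
        have hEef : 1 ≤ E₁ * ef := one_le_exp_mul_of_le_one hδ0 hLk hr1
        have hhtilde : ∀ b, ¬ Inside Ω₀ b → (fun b => (1 - χ b.tgt) • h b) b = 0 := fun b hb => by
          simp only [hh₀ b hb, smul_zero]
        have hsepA : ∀ (b : HiggsLattice.PBond P 0) (x' : HiggsLattice.Site P 0), (fun b => (1 - χ b.tgt) • h b) b ≠ 0 → g' x' ≠ 0 →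
            r' - 1 ≤ (HiggsLattice.Site.tdist b.src x' : ℝ) := by
          intro b x' hb hx'
          have hhb : h b ≠ 0 := by intro h0; exact hb (by simp only [h0, smul_zero])
          have hχb : χ b.tgt ≠ 1 := by intro h0; exact hb (by simp only [h0, sub_self, zero_smul])
          have hinb : Inside Ω b := by by_contra h0; exact hhb (hh b h0)
          have h0 := hr' x' b.tgt hx' (hTχ _ hinb.2 hχb)
          have h1 := tdist_triangle_real x' b.src b.tgt
          have h2 := tdist_src_tgt_le_one b
          rw [tdist_comm x' b.src] at h1
          linarith
        have hp := pairing_DG_of_coercive_any C A hk Ω₀ hΩ₀ hmsq hak hγ hlow₀ hδ0 hδ1 hδ _ hhtilde g' (r' - 1) hsepA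
        rw [← hu₀] at hp
        have hn : Real.sqrt (bondInner (fun b => (1 - χ b.tgt) • h b) (fun b => (1 - χ b.tgt) • h b)) ≤ nh :=
          Real.sqrt_le_sqrt (bondInner_oneSubTgt_le χ hχ0 hχ1 h)
        have s1 := exp_shift_one hδ0 hLk r'
        calc _ ≤ _ := hp
          _ = (cD * P.mesh k * E₁ * ng') * (Real.exp (-(δ * ((r' - 1) / (P.L : ℝ) ^ k)))
                * Real.sqrt (bondInner (fun b => (1 - χ b.tgt) • h b) (fun b => (1 - χ b.tgt) • h b))) := by ring
          _ ≤ (cD * P.mesh k * E₁ * ng') * ((E₁ * ef') * nh) :=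
              mul_le_mul_of_nonneg_left (mul_le_mul s1 hn (Real.sqrt_nonneg _) (by positivity)) (by positivity)
          _ = 1 * (cD * E₁ ^ 2 * P.mesh k * ef' * nh * ng') := by ring
          _ ≤ (E₁ * ef) * (cD * E₁ ^ 2 * P.mesh k * ef' * nh * ng') := mul_le_mul_of_nonneg_right hEef (by positivity)
          _ = cD * E₁ ^ 3 * P.mesh k * ef * ef' * nh * ng' := by ring
    -- (A2)
    have hA2 : |∑ b : HiggsLattice.PBond P 0, P.mesh 0 ^ P.d * (((P.mesh 0)⁻¹ * (χ b.tgt - χ b.src)) * ⟪h b, u₀ b.src⟫_ℝ)|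
        ≤ κ * (P.mesh 0)⁻¹ * P.mesh k * Real.sqrt P.d * (2 / γ) * P.mesh k * ef * ef' * nh * ng' := by
      by_cases hA20 : ∑ b : HiggsLattice.PBond P 0, P.mesh 0 ^ P.d * (((P.mesh 0)⁻¹ * (χ b.tgt - χ b.src)) * ⟪h b, u₀ b.src⟫_ℝ) = 0
      · rw [hA20, abs_zero]; positivity
      · obtain ⟨b₁, -, hb₁⟩ := Finset.exists_ne_zero_of_sum_ne_zero hA20
        have hhb₁ : h b₁ ≠ 0 := by
          intro h0; exact hb₁ (by rw [h0, inner_zero_left, mul_zero, mul_zero])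
        have hjb₁ : χ b₁.tgt ≠ χ b₁.src := by
          intro h0; exact hb₁ (by rw [h0, sub_self, mul_zero, zero_mul, mul_zero])
        have hin : Inside Ω b₁ := by by_contra h0; exact hhb₁ (hh b₁ h0)
        have hbS : b₁ ∈ S := hS b₁ hin hjb₁
        have hr0 : r ≤ 0 := by
          have h0 := hr b₁ b₁.src hhb₁ (hTS b₁ hbS)
          rw [tdist_self] at h0; exact_mod_cast h0
        have hef1 : 1 ≤ ef := one_le_exp_of_le_zero hδ0 hLk hr0
        have hhS' : ∀ b, h b ≠ 0 → χ b.tgt ≠ χ b.src → b ∈ S :=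
          fun b hb hj => hS b (by by_contra h0; exact hb (hh b h0)) hj
        have hj := abs_sum_jump_le χ hκ0 hκ S h hhS' u₀
        have hsb := sum_bond_le S T hTS h u₀
        have hn : Real.sqrt (bondInner (fun b => if b ∈ S then h b else 0) (fun b => if b ∈ S then h b else 0)) ≤ nh :=
          Real.sqrt_le_sqrt (bondInner_indicator_self_le S h)
        calc _ ≤ _ := hj
          _ ≤ κ * (P.mesh 0)⁻¹ * (nh * (Real.sqrt P.d * (2 / γ * P.mesh k ^ 2 * ef' * ng'))) := by
              refine mul_le_mul_of_nonneg_left (hsb.trans ?_) (by positivity)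
              exact mul_le_mul hn (mul_le_mul_of_nonneg_left hB₁ (Real.sqrt_nonneg _)) (by positivity) hnh0
          _ = 1 * (κ * (P.mesh 0)⁻¹ * P.mesh k * Real.sqrt P.d * (2 / γ) * P.mesh k * ef' * nh * ng') := by ring
          _ ≤ ef * (κ * (P.mesh 0)⁻¹ * P.mesh k * Real.sqrt P.d * (2 / γ) * P.mesh k * ef' * nh * ng') :=
              mul_le_mul_of_nonneg_right hef1 (by positivity)
          _ = _ := by ring
    calc _ ≤ _ := abs_sub _ _
      _ ≤ _ := add_le_add hA1 hA2
      _ = _ := by ring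
  ---------------------------------------------------------------- assembly
  calc |siteInner g (propagatorK C Ω A msq a k fun x => (1 - χ x) • g' x)
        - ((siteInner v (covLaplacianN C Ω A (fun x => χ x • u₀ x)) - siteInner (fun x => χ x • v x) (covLaplacianN C Ω₀ A u₀))
          + B1.aSeq a P.L k * ((P.mesh k)⁻¹ ^ 2) *
            (siteInner v (projPk C A k (fun x => χ x • u₀ x)) - siteInner (fun x => χ x • v x) (projPk C A k u₀)))
        - siteInner (fun x => (1 - χ x) • g x) u₀|
      ≤ |siteInner g (propagatorK C Ω A msq a k fun x => (1 - χ x) • g' x)|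
        + |(siteInner v (covLaplacianN C Ω A (fun x => χ x • u₀ x)) - siteInner (fun x => χ x • v x) (covLaplacianN C Ω₀ A u₀))
          + B1.aSeq a P.L k * ((P.mesh k)⁻¹ ^ 2) *
            (siteInner v (projPk C A k (fun x => χ x • u₀ x)) - siteInner (fun x => χ x • v x) (projPk C A k u₀))|
        + |siteInner (fun x => (1 - χ x) • g x) u₀| := (abs_sub _ _).trans (add_le_add (abs_sub _ _) le_rfl)
    _ ≤ _ := add_le_add (add_le_add hB hcomm') hA
    _ = _ := by ring

set_option maxHeartbeats 800000 in
/-- **THE THIRD `δG_k(Ω,Ω₀,A)` PAIRING `⟨g, (G^ε_k(Ω,A) − G^ε_k(Ω₀,A))D^{ε*}_Ah′⟩`** (same data; `g ⊂ Ω` a site field at lattice distance `≥ r` from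
`T`, `h′` a bond field vanishing off the bonds inside `Ω` with sources at distance `≥ r′` from `T`): by the symmetry of both propagators and the
adjointness `⟨φ, D^{ε*}_Ah′⟩ = ⟨D^ε_Aφ, h′⟩` it IS the second `δG` pairing with the roles exchanged — `≤ C₁·(L^kε)·e^{−δr/L^k}e^{−δr′/L^k}‖g‖‖h′‖`,
`C₁` as in `deltaG_pairing_DG_of_cutoff`. [cite: Balaban1983RegularityDecay, (1.11) p.573, Cor. 2.3 (2.30) pp.580–581] -/
theorem deltaG_pairing_GDt_of_cutoff (hk : k ≤ P.K) (Ω Ω₀ : Finset (HiggsLattice.Site P 0))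
    (hΩ : ∀ x x' : HiggsLattice.Site P 0, blockIter k x = blockIter k x' → (x ∈ Ω ↔ x' ∈ Ω))
    (hΩ₀ : ∀ x x' : HiggsLattice.Site P 0, blockIter k x = blockIter k x' → (x ∈ Ω₀ ↔ x' ∈ Ω₀)) (hsub : Ω ⊆ Ω₀)
    (hmsq : 0 < msq) (hak : 0 ≤ B1.aSeq a P.L k) {γ : ℝ} (hγ : 0 < γ)
    (hlow : ∀ w : ScalarField P 0 N, (∀ x, x ∉ Ω → w x = 0) →
      γ * ((P.mesh k)⁻¹ ^ 2) * siteInner w w ≤ siteInner w (covOpK C Ω A msq a k w))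
    (hlow₀ : ∀ w : ScalarField P 0 N, (∀ x, x ∉ Ω₀ → w x = 0) →
      γ * ((P.mesh k)⁻¹ ^ 2) * siteInner w w ≤ siteInner w (covOpK C Ω₀ A msq a k w))
    {δ : ℝ} (hδ0 : 0 ≤ δ) (hδ1 : δ ≤ 1) (hδ : 2 * (2 * P.d * δ ^ 2 + B1.aSeq a P.L k * (2 * δ)) ≤ γ)
    (χ : HiggsLattice.Site P 0 → ℝ) (hχ0 : ∀ x, 0 ≤ χ x) (hχ1 : ∀ x, χ x ≤ 1)
    (hχbd : ∀ b : HiggsLattice.PBond P 0, Inside Ω₀ b → ¬ Inside Ω b → χ b.src = 0 ∧ χ b.tgt = 0)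
    {κ : ℝ} (hκ0 : 0 ≤ κ) (hκ : ∀ b : HiggsLattice.PBond P 0, |χ b.tgt - χ b.src| ≤ κ)
    (S : Finset (HiggsLattice.PBond P 0)) (hSin : ∀ b ∈ S, Inside Ω b) (hS : ∀ b, Inside Ω b → χ b.tgt ≠ χ b.src → b ∈ S)
    {κ' : ℝ} (hκ'0 : 0 ≤ κ') (hosc : ∀ x x' : HiggsLattice.Site P 0, blockIter k x = blockIter k x' → |χ x - χ x'| ≤ κ')
    (Y : Finset (HiggsLattice.Site P k))
    (hY : ∀ x x' : HiggsLattice.Site P 0, blockIter k x = blockIter k x' → blockIter k x ∉ Y → χ x = χ x')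
    (T : Finset (HiggsLattice.Site P 0)) (hTχ : ∀ x, x ∈ Ω → χ x ≠ 1 → x ∈ T) (hTS : ∀ b ∈ S, b.src ∈ T)
    (hTY : ∀ x, blockIter k x ∈ Y → x ∈ T)
    (g : ScalarField P 0 N) (hgΩ : ∀ x, x ∉ Ω → g x = 0)
    (h' : HiggsLattice.PBond P 0 → E N) (hh' : ∀ b, ¬ Inside Ω b → h' b = 0) (r r' : ℝ)
    (hr : ∀ x t, g x ≠ 0 → t ∈ T → r ≤ (HiggsLattice.Site.tdist x t : ℝ))
    (hr' : ∀ (b : HiggsLattice.PBond P 0) (t : HiggsLattice.Site P 0), h' b ≠ 0 → t ∈ T → r' ≤ (HiggsLattice.Site.tdist b.src t : ℝ)) :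
    |siteInner g (propagatorK C Ω A msq a k (adjA C A h')) - siteInner g (propagatorK C Ω₀ A msq a k (adjA C A h'))|
      ≤ ((2 / Real.sqrt γ + 4 * Real.sqrt P.d * δ / γ) * (Real.exp δ + Real.exp δ ^ 3)
          + κ * (P.mesh 0)⁻¹ * P.mesh k * Real.sqrt P.d *
              (Real.exp δ ^ 2 * ((4 + 2 * δ * Real.sqrt (8 * P.d / γ)) * (2 / γ) + (2 / Real.sqrt γ + 4 * Real.sqrt P.d * δ / γ) ^ 2)
                + 2 / γ)
          + 2 * κ' * B1.aSeq a P.L k * (2 / Real.sqrt γ + 4 * Real.sqrt P.d * δ / γ) * Real.exp δ * (2 / γ))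
        * P.mesh k * Real.exp (-(δ * (r / (P.L : ℝ) ^ k))) * Real.exp (-(δ * (r' / (P.L : ℝ) ^ k)))
        * Real.sqrt (siteInner g g) * Real.sqrt (bondInner h' h') := by
  have e : ∀ Ω' : Finset (HiggsLattice.Site P 0), siteInner g (propagatorK C Ω' A msq a k (adjA C A h'))
      = bondInner h' (covDeriv C A (propagatorK C Ω' A msq a k g)) := by
    intro Ω'
    rw [siteInner_propagatorK_comm C Ω' A msq a k, siteInner_comm, siteInner_adjA, bondInner_comm]
  rw [e Ω, e Ω₀]
  have H := deltaG_pairing_DG_of_cutoff C A hk Ω Ω₀ hΩ hΩ₀ hsub hmsq hak hγ hlow hlow₀ hδ0 hδ1 hδ χ hχ0 hχ1 hχbd hκ0 hκ S hSin hS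
    hκ'0 hosc Y hY T hTχ hTS hTY h' hh' g hgΩ r' r hr' hr
  calc _ ≤ _ := H
    _ = _ := by ring

set_option maxHeartbeats 1600000 in
/-- **THE FOURTH `δG_k(Ω,Ω₀,A)` PAIRING `⟨h, D^ε_A(G^ε_k(Ω,A) − G^ε_k(Ω₀,A))D^{ε*}_Ah′⟩` FROM A COERCIVITY CONSTANT AND AN ADAPTED CUTOFF**
(same data; `h, h′` bond fields vanishing off the bonds inside `Ω` with sources at lattice distance `≥ r`, `≥ r′` from `T`):
`|⟨h, D^ε_A(G^ε_k(Ω,A) − G^ε_k(Ω₀,A))D^{ε*}_Ah′⟩| ≤ C₃·e^{−δr/L^k}e^{−δr′/L^k}‖h‖‖h′‖`, `C₃ = c₂(e^{3δ} + e^{4δ}) + κε^{−1}(L^kε)√d·c_De^{δ}(2c₂e^{2δ} + 2)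
+ 2κ′a_kc_D²e^{2δ}` — no power of `L^kε`, as for the plain fourth pairing; the boundary terms through the covariant Leibniz rule on `1 − χ` and the
adjoint identity `(1−χ)D^{ε*}_Ah′ = D^{ε*}_A((1−χ∘tgt)h′) − m`. [cite: Balaban1983RegularityDecay, (1.11) p.573, Cor. 2.3 (2.30) pp.580–581] -/
theorem deltaG_pairing_DGDt_of_cutoff (hk : k ≤ P.K) (Ω Ω₀ : Finset (HiggsLattice.Site P 0))
    (hΩ : ∀ x x' : HiggsLattice.Site P 0, blockIter k x = blockIter k x' → (x ∈ Ω ↔ x' ∈ Ω))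
    (hΩ₀ : ∀ x x' : HiggsLattice.Site P 0, blockIter k x = blockIter k x' → (x ∈ Ω₀ ↔ x' ∈ Ω₀)) (hsub : Ω ⊆ Ω₀)
    (hmsq : 0 < msq) (hak : 0 ≤ B1.aSeq a P.L k) {γ : ℝ} (hγ : 0 < γ)
    (hlow : ∀ w : ScalarField P 0 N, (∀ x, x ∉ Ω → w x = 0) →
      γ * ((P.mesh k)⁻¹ ^ 2) * siteInner w w ≤ siteInner w (covOpK C Ω A msq a k w))
    (hlow₀ : ∀ w : ScalarField P 0 N, (∀ x, x ∉ Ω₀ → w x = 0) →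
      γ * ((P.mesh k)⁻¹ ^ 2) * siteInner w w ≤ siteInner w (covOpK C Ω₀ A msq a k w))
    {δ : ℝ} (hδ0 : 0 ≤ δ) (hδ1 : δ ≤ 1) (hδ : 2 * (2 * P.d * δ ^ 2 + B1.aSeq a P.L k * (2 * δ)) ≤ γ)
    (χ : HiggsLattice.Site P 0 → ℝ) (hχ0 : ∀ x, 0 ≤ χ x) (hχ1 : ∀ x, χ x ≤ 1)
    (hχbd : ∀ b : HiggsLattice.PBond P 0, Inside Ω₀ b → ¬ Inside Ω b → χ b.src = 0 ∧ χ b.tgt = 0)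
    {κ : ℝ} (hκ0 : 0 ≤ κ) (hκ : ∀ b : HiggsLattice.PBond P 0, |χ b.tgt - χ b.src| ≤ κ)
    (S : Finset (HiggsLattice.PBond P 0)) (hSin : ∀ b ∈ S, Inside Ω b) (hS : ∀ b, Inside Ω b → χ b.tgt ≠ χ b.src → b ∈ S)
    {κ' : ℝ} (hκ'0 : 0 ≤ κ') (hosc : ∀ x x' : HiggsLattice.Site P 0, blockIter k x = blockIter k x' → |χ x - χ x'| ≤ κ')
    (Y : Finset (HiggsLattice.Site P k))
    (hY : ∀ x x' : HiggsLattice.Site P 0, blockIter k x = blockIter k x' → blockIter k x ∉ Y → χ x = χ x')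
    (T : Finset (HiggsLattice.Site P 0)) (hTχ : ∀ x, x ∈ Ω → χ x ≠ 1 → x ∈ T) (hTS : ∀ b ∈ S, b.src ∈ T)
    (hTY : ∀ x, blockIter k x ∈ Y → x ∈ T)
    (h h' : HiggsLattice.PBond P 0 → E N) (hh : ∀ b, ¬ Inside Ω b → h b = 0) (hh' : ∀ b, ¬ Inside Ω b → h' b = 0) (r r' : ℝ)
    (hr : ∀ (b : HiggsLattice.PBond P 0) (t : HiggsLattice.Site P 0), h b ≠ 0 → t ∈ T → r ≤ (HiggsLattice.Site.tdist b.src t : ℝ))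
    (hr' : ∀ (b : HiggsLattice.PBond P 0) (t : HiggsLattice.Site P 0), h' b ≠ 0 → t ∈ T → r' ≤ (HiggsLattice.Site.tdist b.src t : ℝ)) :
    |bondInner h (covDeriv C A (propagatorK C Ω A msq a k (adjA C A h')))
        - bondInner h (covDeriv C A (propagatorK C Ω₀ A msq a k (adjA C A h')))|
      ≤ ((4 + 2 * δ * Real.sqrt (8 * P.d / γ)) * (Real.exp δ ^ 3 + Real.exp δ ^ 4)
          + κ * (P.mesh 0)⁻¹ * P.mesh k * Real.sqrt P.d * (2 / Real.sqrt γ + 4 * Real.sqrt P.d * δ / γ) * Real.exp δ *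
              (2 * (4 + 2 * δ * Real.sqrt (8 * P.d / γ)) * Real.exp δ ^ 2 + 2)
          + 2 * κ' * B1.aSeq a P.L k * (2 / Real.sqrt γ + 4 * Real.sqrt P.d * δ / γ) ^ 2 * Real.exp δ ^ 2)
        * Real.exp (-(δ * (r / (P.L : ℝ) ^ k))) * Real.exp (-(δ * (r' / (P.L : ℝ) ^ k)))
        * Real.sqrt (bondInner h h) * Real.sqrt (bondInner h' h') := by
  classical
  have hM : 0 < P.mesh k := P.mesh_pos k
  have hm0 : 0 < P.mesh 0 := P.mesh_pos 0
  have hLk : (1 : ℝ) ≤ (P.L : ℝ) ^ k := by exact_mod_cast Nat.one_le_pow _ _ P.hL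
  have hLpos : (0 : ℝ) < (P.L : ℝ) ^ k := by linarith
  have hh₀ : ∀ b, ¬ Inside Ω₀ b → h b = 0 := fun b hb => hh b (fun hin => hb ⟨hsub hin.1, hsub hin.2⟩)
  have hh'₀ : ∀ b, ¬ Inside Ω₀ b → h' b = 0 := fun b hb => hh' b (fun hin => hb ⟨hsub hin.1, hsub hin.2⟩)
  have hSin₀ : ∀ b ∈ S, Inside Ω₀ b := fun b hb => ⟨hsub (hSin b hb).1, hsub (hSin b hb).2⟩
  -- abbreviations
  set cD := 2 / Real.sqrt γ + 4 * Real.sqrt P.d * δ / γ with hcD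
  set c₂ := 4 + 2 * δ * Real.sqrt (8 * P.d / γ) with hc₂
  set E₁ := Real.exp δ with hE₁
  have hcD0 : 0 ≤ cD := by positivity
  have hc₂0 : 0 ≤ c₂ := by positivity
  have hE₁0 : 0 < E₁ := Real.exp_pos δ
  set ef := Real.exp (-(δ * (r / (P.L : ℝ) ^ k))) with hef
  set ef' := Real.exp (-(δ * (r' / (P.L : ℝ) ^ k))) with hef'
  have hef0 : 0 < ef := Real.exp_pos _
  have hef'0 : 0 < ef' := Real.exp_pos _
  set nh := Real.sqrt (bondInner h h) with hnh
  set nh' := Real.sqrt (bondInner h' h') with hnh'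
  have hnh0 : 0 ≤ nh := Real.sqrt_nonneg _
  have hnh'0 : 0 ≤ nh' := Real.sqrt_nonneg _
  -- the test and source site fields
  set g : ScalarField P 0 N := adjA C A h with hg
  set g' : ScalarField P 0 N := adjA C A h' with hg'
  have hconv : ∀ (Ω' : Finset (HiggsLattice.Site P 0)) (φ : ScalarField P 0 N),
      siteInner g (propagatorK C Ω' A msq a k φ) = bondInner h (covDeriv C A (propagatorK C Ω' A msq a k φ)) := by
    intro Ω' φ
    rw [siteInner_comm, hg, siteInner_adjA, bondInner_comm]
  rw [← hconv Ω g', ← hconv Ω₀ g', deltaG_split C A Ω Ω₀ hmsq hak χ g g']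
  set v : ScalarField P 0 N := propagatorK C Ω A msq a k g with hv
  set u₀ : ScalarField P 0 N := propagatorK C Ω₀ A msq a k g' with hu₀
  ---------------------------------------------------------------- separations
  set SY : Finset (HiggsLattice.Site P 0) := Finset.univ.filter fun x => blockIter k x ∈ Y with hSY
  have hSYT : ∀ x ∈ SY, x ∈ T := fun x hx => hTY x (Finset.mem_filter.1 hx).2
  have hYeq : ∀ w : ScalarField P 0 N, (fun x => if blockIter k x ∈ Y then w x else 0) = fun x => if x ∈ SY then w x else 0 := by
    intro w; funext x
    simp only [hSY, Finset.mem_filter, Finset.mem_univ, true_and]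
  have hsepS : ∀ (η : HiggsLattice.PBond P 0 → E N) (ρ : ℝ),
      (∀ (b : HiggsLattice.PBond P 0) (t : HiggsLattice.Site P 0), η b ≠ 0 → t ∈ T → ρ ≤ (HiggsLattice.Site.tdist b.src t : ℝ)) →
      ∀ B ∈ S, ∀ b : HiggsLattice.PBond P 0, η b ≠ 0 →
        ρ - 1 ≤ (HiggsLattice.Site.tdist B.src b.src : ℝ) ∧ ρ - 1 ≤ (HiggsLattice.Site.tdist B.src b.tgt : ℝ) := by
    intro η ρ hρ B hB b hb
    have h1 : ρ ≤ (HiggsLattice.Site.tdist b.src B.src : ℝ) := hρ b B.src hb (hTS B hB)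
    rw [tdist_comm] at h1
    have h2 := tdist_triangle_real B.src b.tgt b.src
    have h3 : (HiggsLattice.Site.tdist b.tgt b.src : ℝ) ≤ 1 := by rw [tdist_comm]; exact tdist_src_tgt_le_one b
    constructor <;> linarith
  have hsepTv : ∀ b : HiggsLattice.PBond P 0, h b ≠ 0 → ∀ t ∈ T, r ≤ (HiggsLattice.Site.tdist b.src t : ℝ) :=
    fun b hb t ht => hr b t hb ht
  have hsepYv : ∀ b : HiggsLattice.PBond P 0, h b ≠ 0 → ∀ t ∈ SY, r ≤ (HiggsLattice.Site.tdist b.src t : ℝ) :=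
    fun b hb t ht => hr b t hb (hSYT t ht)
  have hsepTu : ∀ b : HiggsLattice.PBond P 0, h' b ≠ 0 → ∀ t ∈ T, r' ≤ (HiggsLattice.Site.tdist b.src t : ℝ) :=
    fun b hb t ht => hr' b t hb ht
  have hsepYu : ∀ b : HiggsLattice.PBond P 0, h' b ≠ 0 → ∀ t ∈ SY, r' ≤ (HiggsLattice.Site.tdist b.src t : ℝ) :=
    fun b hb t ht => hr' b t hb (hSYT t ht)
  ---------------------------------------------------------------- the six restricted norms
  have nTv := restricted_norm_GDt_le C A hk Ω hΩ hmsq hak hγ hlow hδ0 hδ1 hδ T h hh r hsepTv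
  have nSv := restricted_norm_DGDt_le C A hk Ω hΩ hmsq hak hγ hlow hδ0 hδ1 hδ S hSin h hh (r - 1) (hsepS h r hr)
  have nYv := restricted_norm_GDt_le C A hk Ω hΩ hmsq hak hγ hlow hδ0 hδ1 hδ SY h hh r hsepYv
  have nTu := restricted_norm_GDt_le C A hk Ω₀ hΩ₀ hmsq hak hγ hlow₀ hδ0 hδ1 hδ T h' hh'₀ r' hsepTu
  have nSu := restricted_norm_DGDt_le C A hk Ω₀ hΩ₀ hmsq hak hγ hlow₀ hδ0 hδ1 hδ S hSin₀ h' hh'₀ (r' - 1) (hsepS h' r' hr')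
  have nYu := restricted_norm_GDt_le C A hk Ω₀ hΩ₀ hmsq hak hγ hlow₀ hδ0 hδ1 hδ SY h' hh'₀ r' hsepYu
  rw [← hg, ← hv] at nTv nSv nYv
  rw [← hg', ← hu₀] at nTu nSu nYu
  have hshiftS : ∀ (ρ n : ℝ), 0 ≤ n →
      c₂ * E₁ * Real.exp (-(δ * ((ρ - 1) / (P.L : ℝ) ^ k))) * n ≤ c₂ * E₁ ^ 2 * Real.exp (-(δ * (ρ / (P.L : ℝ) ^ k))) * n := by
    intro ρ n hn
    have s1 := exp_shift_one hδ0 hLk ρ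
    calc c₂ * E₁ * Real.exp (-(δ * ((ρ - 1) / (P.L : ℝ) ^ k))) * n = (c₂ * E₁ * n) * Real.exp (-(δ * ((ρ - 1) / (P.L : ℝ) ^ k))) := by
          ring
      _ ≤ (c₂ * E₁ * n) * (E₁ * Real.exp (-(δ * (ρ / (P.L : ℝ) ^ k)))) := mul_le_mul_of_nonneg_left s1 (by positivity)
      _ = _ := by ring
  have hA₁ : Real.sqrt (siteInner (fun x => if x ∈ T then v x else 0) (fun x => if x ∈ T then v x else 0))
      ≤ cD * P.mesh k * E₁ * ef * nh := nTv
  have hA₂ : Real.sqrt (bondInner (fun b => if b ∈ S then covDeriv C A v b else 0) (fun b => if b ∈ S then covDeriv C A v b else 0))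
      ≤ c₂ * E₁ ^ 2 * ef * nh := nSv.trans (hshiftS r nh hnh0)
  have hA₃ : Real.sqrt (siteInner (fun x => if blockIter k x ∈ Y then v x else 0) (fun x => if blockIter k x ∈ Y then v x else 0))
      ≤ cD * P.mesh k * E₁ * ef * nh := by rw [hYeq]; exact nYv
  have hB₁ : Real.sqrt (siteInner (fun x => if x ∈ T then u₀ x else 0) (fun x => if x ∈ T then u₀ x else 0))
      ≤ cD * P.mesh k * E₁ * ef' * nh' := nTu
  have hB₂ : Real.sqrt (bondInner (fun b => if b ∈ S then covDeriv C A u₀ b else 0) (fun b => if b ∈ S then covDeriv C A u₀ b else 0))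
      ≤ c₂ * E₁ ^ 2 * ef' * nh' := nSu.trans (hshiftS r' nh' hnh'0)
  have hB₃ : Real.sqrt (siteInner (fun x => if blockIter k x ∈ Y then u₀ x else 0) (fun x => if blockIter k x ∈ Y then u₀ x else 0))
      ≤ cD * P.mesh k * E₁ * ef' * nh' := by rw [hYeq]; exact nYu
  ---------------------------------------------------------------- the commutator term
  have hcomm := commutator_le C A hk Ω Ω₀ hsub hak χ hχbd hκ0 hκ S hS hκ'0 hosc Y hY T hTS v u₀
    (a₁ := cD * P.mesh k * E₁ * ef * nh) (a₂ := c₂ * E₁ ^ 2 * ef * nh) (a₃ := cD * P.mesh k * E₁ * ef * nh)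
    (b₁ := cD * P.mesh k * E₁ * ef' * nh') (b₂ := c₂ * E₁ ^ 2 * ef' * nh') (b₃ := cD * P.mesh k * E₁ * ef' * nh')
    (by positivity) (by positivity) hA₁ hA₂ hA₃ hB₁ hB₂ hB₃
  have hcomm' : |(siteInner v (covLaplacianN C Ω A (fun x => χ x • u₀ x)) - siteInner (fun x => χ x • v x) (covLaplacianN C Ω₀ A u₀))
        + B1.aSeq a P.L k * ((P.mesh k)⁻¹ ^ 2) *
          (siteInner v (projPk C A k (fun x => χ x • u₀ x)) - siteInner (fun x => χ x • v x) (projPk C A k u₀))|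
      ≤ (κ * (P.mesh 0)⁻¹ * P.mesh k * Real.sqrt P.d * cD * E₁ * (2 * c₂ * E₁ ^ 2)
          + 2 * κ' * B1.aSeq a P.L k * cD ^ 2 * E₁ ^ 2) * ef * ef' * nh * nh' := by
    refine hcomm.trans (le_of_eq ?_)
    field_simp
    ring
  ---------------------------------------------------------------- boundary term (B): ⟨g, G_Ω((1−χ)D^{ε*}h′)⟩ = ⟨h, D_AG_Ω(D^{ε*}h̃′ − m)⟩
  have hB : |siteInner g (propagatorK C Ω A msq a k (fun x => (1 - χ x) • g' x))|
      ≤ (c₂ * E₁ ^ 3 + κ * (P.mesh 0)⁻¹ * P.mesh k * cD * Real.sqrt P.d * E₁) * ef * ef' * nh * nh' := by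
    have e1 : (fun x => (1 - χ x) • g' x) = adjA C A (fun b => (1 - χ b.tgt) • h' b)
        - fun x => (P.mesh 0)⁻¹ • ∑ ν : Fin P.d, (χ (x.shift ν) - χ x) • h' ⟨x, ν⟩ := by
      rw [hg']; exact oneSub_smul_adjA C A χ h'
    rw [e1, map_sub, siteInner_sub_right]
    set ht' : HiggsLattice.PBond P 0 → E N := fun b => (1 - χ b.tgt) • h' b with hht'
    set m : ScalarField P 0 N := fun x => (P.mesh 0)⁻¹ • ∑ ν : Fin P.d, (χ (x.shift ν) - χ x) • h' ⟨x, ν⟩ with hm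
    have hht'supp : ∀ b, ¬ Inside Ω b → ht' b = 0 := fun b hb => by simp only [hht', hh' b hb, smul_zero]
    have hnt' : Real.sqrt (bondInner ht' ht') ≤ nh' := Real.sqrt_le_sqrt (bondInner_oneSubTgt_le χ hχ0 hχ1 h')
    -- (B1) the fourth pairing with source h̃′
    have hB1 : |siteInner g (propagatorK C Ω A msq a k (adjA C A ht'))| ≤ c₂ * E₁ ^ 3 * ef * ef' * nh * nh' := by
      rw [hconv Ω]
      by_cases hz : ht' = 0
      · rw [hz, adjA_zero, map_zero]
        have h0 : bondInner h (covDeriv C A (0 : ScalarField P 0 N)) = 0 := by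
          unfold bondInner
          refine Finset.sum_eq_zero fun b _ => ?_
          rw [covDeriv_eq]; simp
        rw [h0, abs_zero]; positivity
      · obtain ⟨b₁, hb₁⟩ : ∃ b, ht' b ≠ 0 := by
          by_contra hne
          push Not at hne
          exact hz (funext fun b => hne b)
        have hhb₁ : h' b₁ ≠ 0 := by intro h0; exact hb₁ (by simp only [hht', h0, smul_zero])
        have hχb₁ : χ b₁.tgt ≠ 1 := by intro h0; exact hb₁ (by simp only [hht', h0, sub_self, zero_smul])
        have hin : Inside Ω b₁ := by by_contra h0; exact hhb₁ (hh' b₁ h0)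
        have hr1 : r' ≤ 1 := by
          have h0 := hr' b₁ b₁.tgt hhb₁ (hTχ _ hin.2 hχb₁)
          have h1 := tdist_src_tgt_le_one b₁
          linarith
        have hEef' : 1 ≤ E₁ * ef' := one_le_exp_mul_of_le_one hδ0 hLk hr1
        have hsepB1 : ∀ b b' : HiggsLattice.PBond P 0, h b ≠ 0 → ht' b' ≠ 0 →
            r - 1 ≤ (HiggsLattice.Site.tdist b.src b'.src : ℝ) ∧ r - 1 ≤ (HiggsLattice.Site.tdist b.src b'.tgt : ℝ) := by
          intro b b' hb hb'
          have hhb' : h' b' ≠ 0 := by intro h0; exact hb' (by simp only [hht', h0, smul_zero])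
          have hχb' : χ b'.tgt ≠ 1 := by intro h0; exact hb' (by simp only [hht', h0, sub_self, zero_smul])
          have hinb' : Inside Ω b' := by by_contra h0; exact hhb' (hh' b' h0)
          have h0 := hr b b'.tgt hb (hTχ _ hinb'.2 hχb')
          have h1 := tdist_triangle_real b.src b'.src b'.tgt
          have h2 := tdist_src_tgt_le_one b'
          constructor <;> linarith
        have hp := pairing_DGDt_of_coercive C A hk Ω hΩ hmsq hak hγ hlow hδ0 hδ1 hδ h ht' hh hht'supp (r - 1) hsepB1
        change |bondInner h (covDeriv C A (propagatorK C Ω A msq a k (adjA C A ht')))| ≤ _ at hp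
        have s1 := exp_shift_one hδ0 hLk r
        calc _ ≤ _ := hp
          _ = (c₂ * E₁ * nh) * (Real.exp (-(δ * ((r - 1) / (P.L : ℝ) ^ k))) * Real.sqrt (bondInner ht' ht')) := by ring
          _ ≤ (c₂ * E₁ * nh) * ((E₁ * ef) * nh') :=
              mul_le_mul_of_nonneg_left (mul_le_mul s1 hnt' (Real.sqrt_nonneg _) (by positivity)) (by positivity)
          _ = 1 * (c₂ * E₁ ^ 2 * ef * nh * nh') := by ring
          _ ≤ (E₁ * ef') * (c₂ * E₁ ^ 2 * ef * nh * nh') := mul_le_mul_of_nonneg_right hEef' (by positivity)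
          _ = c₂ * E₁ ^ 3 * ef * ef' * nh * nh' := by ring
    -- (B2) the second pairing with the jump field m as source
    have hB2 : |siteInner g (propagatorK C Ω A msq a k m)| ≤ κ * (P.mesh 0)⁻¹ * P.mesh k * cD * Real.sqrt P.d * E₁ * ef * ef' * nh * nh' := by
      rw [hconv Ω]
      by_cases hz : m = 0
      · rw [hz, map_zero]
        have h0 : bondInner h (covDeriv C A (0 : ScalarField P 0 N)) = 0 := by
          unfold bondInner
          refine Finset.sum_eq_zero fun b _ => ?_
          rw [covDeriv_eq]; simp
        rw [h0, abs_zero]; positivity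
      · -- a point of the support of m: a jump bond carrying h′, hence in S, hence r′ ≤ 0
        obtain ⟨x₁, hx₁⟩ : ∃ x, m x ≠ 0 := by
          by_contra hne
          push Not at hne
          exact hz (funext fun x => hne x)
        obtain ⟨ν₁, hj₁, hh₁⟩ := exists_of_jumpField_ne_zero χ h' hx₁
        have hin₁ : Inside Ω (⟨x₁, ν₁⟩ : HiggsLattice.PBond P 0) := by by_contra h0; exact hh₁ (hh' _ h0)
        have hS₁ : (⟨x₁, ν₁⟩ : HiggsLattice.PBond P 0) ∈ S := hS _ hin₁ hj₁
        have hr0 : r' ≤ 0 := by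
          have h0 := hr' ⟨x₁, ν₁⟩ x₁ hh₁ (hTS _ hS₁)
          have h1 : HiggsLattice.Site.tdist (⟨x₁, ν₁⟩ : HiggsLattice.PBond P 0).src x₁ = 0 := tdist_self x₁
          rw [h1] at h0; exact_mod_cast h0
        have hef'1 : 1 ≤ ef' := one_le_exp_of_le_zero hδ0 hLk hr0
        have hsepB2 : ∀ (b : HiggsLattice.PBond P 0) (x : HiggsLattice.Site P 0), h b ≠ 0 → m x ≠ 0 →
            r ≤ (HiggsLattice.Site.tdist b.src x : ℝ) := by
          intro b x hb hx
          obtain ⟨ν, hj, hhν⟩ := exists_of_jumpField_ne_zero χ h' hx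
          have hin : Inside Ω (⟨x, ν⟩ : HiggsLattice.PBond P 0) := by by_contra h0; exact hhν (hh' _ h0)
          have hSx : (⟨x, ν⟩ : HiggsLattice.PBond P 0) ∈ S := hS _ hin hj
          exact hr b x hb (hTS _ hSx)
        have hp := pairing_DG_of_coercive_any C A hk Ω hΩ hmsq hak hγ hlow hδ0 hδ1 hδ h hh m r hsepB2
        have hmn : Real.sqrt (siteInner m m) ≤ κ * (P.mesh 0)⁻¹ * (Real.sqrt P.d * nh') := by
          have h0 := siteInner_jumpField_le χ hκ0 hκ h'
          calc Real.sqrt (siteInner m m) ≤ Real.sqrt ((κ * (P.mesh 0)⁻¹) ^ 2 * P.d * bondInner h' h') := Real.sqrt_le_sqrt h0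
            _ = κ * (P.mesh 0)⁻¹ * (Real.sqrt P.d * nh') := by
                rw [Real.sqrt_mul (by positivity), Real.sqrt_mul (by positivity), Real.sqrt_sq (by positivity), hnh']
                ring
        calc _ ≤ _ := hp
          _ ≤ cD * P.mesh k * E₁ * ef * nh * (κ * (P.mesh 0)⁻¹ * (Real.sqrt P.d * nh')) :=
              mul_le_mul_of_nonneg_left hmn (by positivity)
          _ = 1 * (κ * (P.mesh 0)⁻¹ * P.mesh k * cD * Real.sqrt P.d * E₁ * ef * nh * nh') := by ring
          _ ≤ ef' * (κ * (P.mesh 0)⁻¹ * P.mesh k * cD * Real.sqrt P.d * E₁ * ef * nh * nh') :=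
              mul_le_mul_of_nonneg_right hef'1 (by positivity)
          _ = _ := by ring
    calc _ ≤ _ := abs_sub _ _
      _ ≤ _ := add_le_add hB1 hB2
      _ = _ := by ring
  ---------------------------------------------------------------- boundary term (A): ⟨(1−χ)g, u₀⟩ = ⟨h, D_A((1−χ)u₀)⟩
  have hA : |siteInner (fun x => (1 - χ x) • g x) u₀|
      ≤ (c₂ * E₁ ^ 4 + κ * (P.mesh 0)⁻¹ * P.mesh k * cD * Real.sqrt P.d * E₁) * ef * ef' * nh * nh' := by
    have e1 : siteInner (fun x => (1 - χ x) • g x) u₀ = bondInner h (covDeriv C A (fun x => (1 - χ x) • u₀ x)) := by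
      rw [← siteInner_smulFun_comm (fun x => 1 - χ x) g u₀, siteInner_comm, hg, siteInner_adjA, bondInner_comm]
    rw [e1, bondInner_covDeriv_oneSub]
    -- (A1) the fourth pairing on Ω₀ with test h̃
    have hA1 : |bondInner (fun b => (1 - χ b.tgt) • h b) (covDeriv C A u₀)| ≤ c₂ * E₁ ^ 4 * ef * ef' * nh * nh' := by
      by_cases hA10 : bondInner (fun b => (1 - χ b.tgt) • h b) (covDeriv C A u₀) = 0
      · rw [hA10, abs_zero]; positivity
      · obtain ⟨b₁, hb₁⟩ := exists_of_bondInner_ne_zero _ _ hA10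
        have hhb₁ : h b₁ ≠ 0 := by intro h0; exact hb₁ (by simp only [h0, smul_zero])
        have hχb₁ : χ b₁.tgt ≠ 1 := by intro h0; exact hb₁ (by simp only [h0, sub_self, zero_smul])
        have hin : Inside Ω b₁ := by by_contra h0; exact hhb₁ (hh b₁ h0)
        have hr1 : r ≤ 1 := by
          have h0 := hr b₁ b₁.tgt hhb₁ (hTχ _ hin.2 hχb₁)
          have h1 := tdist_src_tgt_le_one b₁
          linarith
        have hEef : 1 ≤ E₁ * ef := one_le_exp_mul_of_le_one hδ0 hLk hr1
        have hhtilde : ∀ b, ¬ Inside Ω₀ b → (fun b => (1 - χ b.tgt) • h b) b = 0 := fun b hb => by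
          simp only [hh₀ b hb, smul_zero]
        have hsepA : ∀ b b' : HiggsLattice.PBond P 0, (fun b => (1 - χ b.tgt) • h b) b ≠ 0 → h' b' ≠ 0 →
            r' - 2 ≤ (HiggsLattice.Site.tdist b.src b'.src : ℝ) ∧ r' - 2 ≤ (HiggsLattice.Site.tdist b.src b'.tgt : ℝ) := by
          intro b b' hb hb'
          have hhb : h b ≠ 0 := by intro h0; exact hb (by simp only [h0, smul_zero])
          have hχb : χ b.tgt ≠ 1 := by intro h0; exact hb (by simp only [h0, sub_self, zero_smul])
          have hinb : Inside Ω b := by by_contra h0; exact hhb (hh b h0)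
          have h0 := hr' b' b.tgt hb' (hTχ _ hinb.2 hχb)
          have h1 := tdist_triangle_real b'.src b.src b.tgt
          have h2 := tdist_src_tgt_le_one b
          have h3 := tdist_triangle_real b.src b'.tgt b'.src
          have h4 : (HiggsLattice.Site.tdist b'.tgt b'.src : ℝ) ≤ 1 := by rw [tdist_comm]; exact tdist_src_tgt_le_one b'
          rw [tdist_comm b'.src b.src] at h1
          constructor <;> linarith
        have hp := pairing_DGDt_of_coercive C A hk Ω₀ hΩ₀ hmsq hak hγ hlow₀ hδ0 hδ1 hδ _ h' hhtilde hh'₀ (r' - 2) hsepA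
        change |bondInner (fun b => (1 - χ b.tgt) • h b) (covDeriv C A u₀)| ≤ _ at hp
        have hn : Real.sqrt (bondInner (fun b => (1 - χ b.tgt) • h b) (fun b => (1 - χ b.tgt) • h b)) ≤ nh :=
          Real.sqrt_le_sqrt (bondInner_oneSubTgt_le χ hχ0 hχ1 h)
        have s2 := exp_shift_two hδ0 hLk r'
        calc _ ≤ _ := hp
          _ = (c₂ * E₁ * nh') * (Real.exp (-(δ * ((r' - 2) / (P.L : ℝ) ^ k)))
                * Real.sqrt (bondInner (fun b => (1 - χ b.tgt) • h b) (fun b => (1 - χ b.tgt) • h b))) := by ring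
          _ ≤ (c₂ * E₁ * nh') * ((E₁ ^ 2 * ef') * nh) :=
              mul_le_mul_of_nonneg_left (mul_le_mul s2 hn (Real.sqrt_nonneg _) (by positivity)) (by positivity)
          _ = 1 * (c₂ * E₁ ^ 3 * ef' * nh * nh') := by ring
          _ ≤ (E₁ * ef) * (c₂ * E₁ ^ 3 * ef' * nh * nh') := mul_le_mul_of_nonneg_right hEef (by positivity)
          _ = c₂ * E₁ ^ 4 * ef * ef' * nh * nh' := by ring
    -- (A2) the jump sum
    have hA2 : |∑ b : HiggsLattice.PBond P 0, P.mesh 0 ^ P.d * (((P.mesh 0)⁻¹ * (χ b.tgt - χ b.src)) * ⟪h b, u₀ b.src⟫_ℝ)|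
        ≤ κ * (P.mesh 0)⁻¹ * P.mesh k * cD * Real.sqrt P.d * E₁ * ef * ef' * nh * nh' := by
      by_cases hA20 : ∑ b : HiggsLattice.PBond P 0, P.mesh 0 ^ P.d * (((P.mesh 0)⁻¹ * (χ b.tgt - χ b.src)) * ⟪h b, u₀ b.src⟫_ℝ) = 0
      · rw [hA20, abs_zero]; positivity
      · obtain ⟨b₁, -, hb₁⟩ := Finset.exists_ne_zero_of_sum_ne_zero hA20
        have hhb₁ : h b₁ ≠ 0 := by
          intro h0; exact hb₁ (by rw [h0, inner_zero_left, mul_zero, mul_zero])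
        have hjb₁ : χ b₁.tgt ≠ χ b₁.src := by
          intro h0; exact hb₁ (by rw [h0, sub_self, mul_zero, zero_mul, mul_zero])
        have hin : Inside Ω b₁ := by by_contra h0; exact hhb₁ (hh b₁ h0)
        have hbS : b₁ ∈ S := hS b₁ hin hjb₁
        have hr0 : r ≤ 0 := by
          have h0 := hr b₁ b₁.src hhb₁ (hTS b₁ hbS)
          rw [tdist_self] at h0; exact_mod_cast h0
        have hef1 : 1 ≤ ef := one_le_exp_of_le_zero hδ0 hLk hr0
        have hhS' : ∀ b, h b ≠ 0 → χ b.tgt ≠ χ b.src → b ∈ S :=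
          fun b hb hj => hS b (by by_contra h0; exact hb (hh b h0)) hj
        have hj := abs_sum_jump_le χ hκ0 hκ S h hhS' u₀
        have hsb := sum_bond_le S T hTS h u₀
        have hn : Real.sqrt (bondInner (fun b => if b ∈ S then h b else 0) (fun b => if b ∈ S then h b else 0)) ≤ nh :=
          Real.sqrt_le_sqrt (bondInner_indicator_self_le S h)
        calc _ ≤ _ := hj
          _ ≤ κ * (P.mesh 0)⁻¹ * (nh * (Real.sqrt P.d * (cD * P.mesh k * E₁ * ef' * nh'))) := by
              refine mul_le_mul_of_nonneg_left (hsb.trans ?_) (by positivity)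
              exact mul_le_mul hn (mul_le_mul_of_nonneg_left hB₁ (Real.sqrt_nonneg _)) (by positivity) hnh0
          _ = 1 * (κ * (P.mesh 0)⁻¹ * P.mesh k * cD * Real.sqrt P.d * E₁ * ef' * nh * nh') := by ring
          _ ≤ ef * (κ * (P.mesh 0)⁻¹ * P.mesh k * cD * Real.sqrt P.d * E₁ * ef' * nh * nh') :=
              mul_le_mul_of_nonneg_right hef1 (by positivity)
          _ = _ := by ring
    calc _ ≤ _ := abs_sub _ _
      _ ≤ _ := add_le_add hA1 hA2
      _ = _ := by ring
  ---------------------------------------------------------------- assembly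
  calc |siteInner g (propagatorK C Ω A msq a k fun x => (1 - χ x) • g' x)
        - ((siteInner v (covLaplacianN C Ω A (fun x => χ x • u₀ x)) - siteInner (fun x => χ x • v x) (covLaplacianN C Ω₀ A u₀))
          + B1.aSeq a P.L k * ((P.mesh k)⁻¹ ^ 2) *
            (siteInner v (projPk C A k (fun x => χ x • u₀ x)) - siteInner (fun x => χ x • v x) (projPk C A k u₀)))
        - siteInner (fun x => (1 - χ x) • g x) u₀|
      ≤ |siteInner g (propagatorK C Ω A msq a k fun x => (1 - χ x) • g' x)|
        + |(siteInner v (covLaplacianN C Ω A (fun x => χ x • u₀ x)) - siteInner (fun x => χ x • v x) (covLaplacianN C Ω₀ A u₀))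
          + B1.aSeq a P.L k * ((P.mesh k)⁻¹ ^ 2) *
            (siteInner v (projPk C A k (fun x => χ x • u₀ x)) - siteInner (fun x => χ x • v x) (projPk C A k u₀))|
        + |siteInner (fun x => (1 - χ x) • g x) u₀| := (abs_sub _ _).trans (add_le_add (abs_sub _ _) le_rfl)
    _ ≤ _ := add_le_add (add_le_add hB hcomm') hA
    _ = _ := by ring

end Assembly

end Literature.MathematicalPhysics.QuantumFieldTheory.Balaban1983to89.B1DeltaGDerivRegularRegion

end
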